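import Literature.Geometry.Kaehler.ComplexTorusLineBundleRadicalModes
import Literature.Geometry.Kaehler.ComplexTorusLineBundleFockSupBound
import Literature.Geometry.Kaehler.ComplexTorusLineBundleDolbeault
import Literature.Analysis.FunctionSpaces.TorusRieszFischerParam
import HarnessLib

/-!
# The Green operator of the radical Laplacian of `L(H, χ)` along `K(L)⁰` and the `∂̄`-exactness of the
# non-vacuum part of `A^{0,•}(L)`; `H^q(X, L) = 0` for all `q` when `L|_{K(L)⁰}` is non-trivial
# (Lange 2023, Theorem 1.6.8 "0 otherwise", with Theorem 1.6.1 for these bundles)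

Layer `Literature/Geometry/Kaehler`, namespace `Literature.Geometry.Kaehler.ComplexTorus`; lane `lit-hodgefound`,
Layer A2 (seat `lit-hodgefound-skel-2`, generation 28), row **A2-94 FILE 2** of
`run/shared/lean/pub/lit-hodgefound/SKELETON.md` — the second file of the programme "Theorem 1.6.1 and
Theorem 1.6.8 for a DEGENERATE line bundle `L = L(H, χ)`", sequel of FILE 1 (`ComplexTorusLineBundleRadicalModes`:
the Fourier modes `f^(m)` of `A^{0,0}(L)` along the subtorus `K(L)⁰`). DEFINITIONS WITH BODIES (`IsPureMode`,
`radMulKernel`, `IsNSForm.radMul`, `radFrame`, `radLaplace`, `IsNSForm.radSymb`, `IsNSForm.radVacSet`,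
`IsNSForm.radVac`, `IsNSForm.radGreenCoeff`, `IsNSForm.radGreen`, `IsNSForm.radGreenForm`, `IsNSForm.radVacForm`,
`diagZero`) and THEOREMS; no named fact, no `sorry`.

## The mathematics

`X = V/Λ`, `L = L(H, χ)` with `H ∈ NS(X)` ARBITRARY (`r` positive, `s` negative eigenvalues, radical
`Λ(L)⁰ = {v | H(v, V) = 0}` of complex dimension `g - r - s`), `K(L)⁰ = Λ(L)⁰/Λ_0` (`Λ_0 = Λ ∩ Λ(L)⁰`),
`χ_0 = χ|_{Λ_0} = e(2πiθ)` (FILE 1: `radChar`, `radTwist`). Lange's **Theorem 1.6.8** [p0068]: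
"`h^q(L) = binom(g-r-s, q-s) Pfr(E)` if `s ≤ q ≤ g-r` and `L|_{K(L)⁰}` is trivial; `0` otherwise", proved in the
book from Theorem 1.6.1 (`H^q(L) ≅ ℋ^q(L)`, quoted from Griffiths–Harris) and the computation of the harmonic
forms. On the tree's carriers (`A^{0,q}(L)` = coefficient families of smooth theta functions, `∂̄ = dbarForm`,
`H^{0,q}_∂̄(X, L) = dbarCohomology`, rows A2-77/A2-79) Theorem 1.6.1 itself has to be PROVED; rows A2-81/82 did
it for `H = 0`, rows A2-88 … A2-93 for non-degenerate `H` (Fock expansion). This file and its sequel treat the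
degenerate case by harmonic analysis ALONG THE RADICAL, which reduces everything to the non-degenerate quotient
`X̄ = X/K(L)⁰`; the present file proves the half that needs no quotient:

**THEOREM (this file).** If `L|_{K(L)⁰}` is non-trivial (`χ_0 ≠ 1`), then every `∂̄`-closed form in
`A^{0,q}(L)` is `∂̄`-exact, `q ≥ 0` (`IsNSForm.dbarClosedForms_le_dbarExactForms_of_radChar_ne_one`); hence
`H^{0,q}_∂̄(X, L) = 0` (`IsNSForm.subsingleton_dbarCohomology_of_radChar_ne_one`,
`IsNSForm.finrank_dbarCohomology_of_radChar_ne_one`), `ℋ^q(L) = 0`, and the comparison map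
`ℋ^q(L) → H^{0,q}_∂̄(X, L)` is bijective (`IsNSForm.harmonicToDolbeault_bijective_of_radChar_ne_one`) — Theorem
1.6.8's "`0` otherwise" together with Theorem 1.6.1 for these bundles, for every `H`-orthogonal frame.
More precisely, for EVERY `L(H, χ)`: a `∂̄`-closed form whose VACUUM PART (below) vanishes is `∂̄`-exact
(`IsNSForm.dbarForm_deltaForm_radGreenForm`, `IsNSForm.sub_radVacForm_mem_dbarExactForms`) — the input of the
sequel, which handles the vacuum part through `X̄`.

**The argument** (ours; Lange's book argues through [GH]). Fix a frame `b = (e_ν)` of `V` containing a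
sub-family `(e_ν)_{ν ∈ Z}` spanning `Λ(L)⁰` over `ℂ`, and weights `k_ν > 0`.
1. (FILE 1) `f ∈ A^{0,0}(L)` has modes `f^(m)`, `m ∈ ℤ^{rk Λ_0}`, `f = Σ_m f^(m)`, each a smooth section of `L`
   with `f^(m)(x + w) = e(2πi(θ + ρ_m)(w)) f^(m)(x)` (`w ∈ Λ(L)⁰`), and `∂̄_w`, `∂_w`, `δ̄_w = -∂_w` act on `f^(m)`
   by the scalars `πi c_w(θ + ρ_m)`, `πi conj(c_w(θ + ρ_m))`. Here (§1) PURE MODES and the modes of a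
   convergent series of pure modes (`IsRadSection.radMode_eq_of_hasSum`), (§2) the MODE MULTIPLIERS
   `T_a f = Σ_m a_m f^(m)` for `a ∈ ℓ¹` (`IsNSForm.radMul`): written as integrals over `K(L)⁰` against the
   continuous kernel `K_a = Σ_m a_m conj(e_m)` they are `C^∞` (tree `contDiff_integral_kernel_mul`), sections of
   `L`, with modes `a_m f^(m)`, and they commute with `∂̄_u`, `∂_u`, `H(u, ·)·`, `δ̄_u` for all `u ∈ V`.
2. (§3) The RADICAL LAPLACIAN `L_Z = Σ_{ν ∈ Z} k_ν⁻¹ δ̄_ν ∂̄_ν` (the `Λ(L)⁰`-part of Lange's `Δ_I`, Prop. 1.6.3 —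
   the same for every `I`, since `h_ν = H(e_ν, e_ν) = 0` on `Z`) acts on the mode `m` by the symbol
   `μ_m = π² Σ_{ν∈Z} k_ν⁻¹ |c_{e_ν}(θ + ρ_m)|² = s(m + t)` of row A2-82 (`greenSymb` of the torus `K(L)⁰` with the
   frame `(e_ν)_{ν∈Z}`), which is coercive (`s(y) ≥ c₀‖y‖²`, A2-82) and vanishes exactly at the VACUUM MODE
   `m₀ = -t` — which exists iff `t ∈ ℤ^r` iff `χ_0 = 1` iff `L|_{K(L)⁰}` is trivial (`IsNSForm.radVacSet`,
   `radVacSet_nonempty_iff`). The vacuum part `P₀ f = f^(m₀)` (`IsNSForm.radVac`; `0` if there is no vacuum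
   mode) is `Λ(L)⁰`-INVARIANT and killed by `∂̄_w`, `∂_w`, `w ∈ Λ(L)⁰`.
3. (§4) The GREEN OPERATOR `G = L_Z^{N-1} ∘ T_a`, `a_m = [m ≠ m₀] μ_m^{-N}`, `N = rk Λ_0` (so that `a ∈ ℓ¹`,
   `Σ_m (1 + |m|²)^{-N} < ∞`, trunk `Torus.summable_inv_one_add_freqNormSq_pow_card`): `G f ∈ A^{0,0}(L)`,
   `(G f)^(m) = [m ≠ m₀] μ_m⁻¹ f^(m)`, **`L_Z G f = f - P₀ f`**, `[G, ∂̄_u] = 0`.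
4. (§5) PROPOSITION 1.6.3 FOR TWO FRAMES (`IsNSForm.dbarForm_deltaForm_add_deltaForm_dbarForm`): if
   `H(e'_μ, e_ν) = 0` for all `μ, ν`, then `∂̄_e δ̄_{e'} + δ̄_{e'} ∂̄_e = Σ_ν k_ν⁻¹ δ̄_{e'_ν} ∂̄_{e_ν}`
   coefficientwise (the cross terms cancel by `[∂̄_{e_ν}, δ̄_{e'_μ}] = π H(e'_μ, e_ν) = 0` and the anticommutation
   of `dv̄_μ`, `dv̄_ν`; the proof is the tree's `laplaceForm_apply` with two frames). With `e' = e` on `Z` and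
   `e' = 0` off `Z` (`radFrame`) the right side is `L_Z`. Hence the HOMOTOPY FORMULA: for `σ ∈ A^{0,q}(L)`
   with `∂̄σ = 0` and `P₀σ = 0`, `τ = Gσ` (coefficientwise) has `∂̄τ = G∂̄σ = 0` and
   `σ = L_Z τ = ∂̄(δ̄_{e'} τ) + δ̄_{e'}(∂̄τ) = ∂̄(δ̄_{e'} G σ)` — `σ` is `∂̄`-exact. No orthogonality of the frame and
   no sign condition on `H` is used.
5. (§6) For an `H`-ORTHOGONAL basis `b` with real diagonal `c_ν = H(e_ν, e_ν)` the zero directions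
   `Z = {ν | c_ν = 0}` automatically span `Λ(L)⁰` (`span_radFrame_diagZero_eq_top`), which gives the headline
   theorems in the form used by rows A2-77/A2-79/A2-93 (frame `⇑b`, `horth`, weights `k`).

In sheaf language this is the statement that `R^• p_* L = 0` for `p : X → X̄` when `L|_{K(L)⁰} ∈ Pic⁰(K(L)⁰)`
is non-trivial (Birkenhake–Lange, *Complex Abelian Varieties*, §3.5, proof of Thm. 3.5.5 via the Leray
spectral sequence; Lange 2023 §1.6.4 Exercise (2) "`H^q(L) ≅ H^s(L) ⊗ H^{q-s}(𝒪_{K(L)⁰})`"); here it is proved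
on the Dolbeault complex by the explicit homotopy of step 4.

## Dictionary

`Φ`, `η = Im H` (`hη : IsNSForm Φ η`), `χ` (`hχ : IsSemicharacter Φ η χ`), `r = subRank (nsRadical Φ η) = rk Λ_0`,
`radSpace Φ η = Φ(Λ(L)⁰)`, `hη.radPeriod`, `t = hη.radTwistParam hχ`, `θ = hη.radTwist hχ`, `ρ_m = hη.radFreq m`,
`f^(m) = hη.radMode hχ f m` (FILE 1); frame `b : Fin g → E`, zero directions `Z : Finset (Fin g)` with
`hZ : ∀ ν ∈ Z, b ν ∈ radSpace Φ η`, `radFrame hZ : Fin g → radSpace Φ η` (`e_ν` on `Z`, `0` off `Z`), weights `k`;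
`T_a = hη.radMul hχ a`, `L_Z = radLaplace η b Z k`, `μ_m = hη.radSymb hχ k hZ m`, `P₀ = hη.radVac hχ`,
`G = hη.radGreen hχ k hZ`; on forms `hη.radGreenForm hχ hZ k`, `hη.radVacForm hχ` (coefficientwise).

## References

* [Lange2023AbelianVarietiesComplex] H. Lange, *Abelian Varieties over the Complex Numbers*, Grundlehren Text
  Edition, Springer 2023 — §1.6.1 Lemma 1.6.2, Prop. 1.6.3, Thm. 1.6.1 [p0063–p0065]; §1.6.3 (1.29), Thm. 1.6.8,
  Lemma 1.6.9, Prop. 1.6.10, Prop. 1.6.11 [p0068–p0070]; §1.6.4 Exercise (2) [p0071]; §1.5.4 (1.22), Lemma 1.5.10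
  [p0058–p0059]; §1.4.1 Prop. 1.4.1.
* [LangeBirkenhake1992] H. Lange, Ch. Birkenhake, *Complex Abelian Varieties*, Grundlehren 302 (1992), §3.4–§3.5
  (cohomology of line bundles; the vanishing theorem of Mumford–Kempf).
* [HuybrechtsCG2005] D. Huybrechts, *Complex Geometry*, Springer 2005, §4.1 Lemma 4.1.12, Thm. 4.1.13, Cor. 4.1.14.
* [Grafakos2014] L. Grafakos, *Classical Fourier Analysis*, 3rd ed., GTM 249 (2014), §3.1.1, Prop. 3.1.2,
  Prop. 3.2.4, Prop. 3.2.5, Prop. 3.2.7 (Fourier series on `𝕋^d`).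

[cite: Lange2023AbelianVarietiesComplex, §1.6.3 Thm. 1.6.8] [cite: Lange2023AbelianVarietiesComplex, §1.6.1 Thm. 1.6.1]
-/

noncomputable section

open scoped Manifold ContDiff Topology Real ComplexConjugate Matrix
open Set Function Complex Finset Module UnitAddTorus MeasureTheory
open Literature.Analysis.Complex Literature.Analysis.FunctionSpaces

namespace Literature.Geometry.Kaehler

namespace ComplexTorus

/-! ## §1 Pure modes; the modes of a convergent series of pure modes -/

section PureMode

variable {ι : Type*} [Fintype ι] [DecidableEq ι] {E : Type*} [NormedAddCommGroup E] [NormedSpace ℂ E]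
  {Φ : (ι → ℝ) ≃L[ℝ] E} {η : E [⋀^Fin 2]→L[ℝ] ℝ} {χ : (ι → ℤ) → ℂ}

/-- **Pure modes of frequency `m`**: radical sections `f` with `f(x + w) = e(2πiθ(w)) e(2πiρ_m(w)) f(x)` for all
`w ∈ Φ(Λ(L)⁰)` — the `m`-th joint eigenspace of the `K(L)⁰`-translations on the radical sections (FILE 1,
`radMode_add_coe`). [cite: Lange2023AbelianVarietiesComplex, §1.6.3 Prop. 1.6.10] [cite: Grafakos2014, Prop. 3.1.2 (6)] -/
structure IsPureMode (hη : IsNSForm Φ η) (hχ : IsSemicharacter Φ η χ) (m : Fin (subRank (nsRadical Φ η)) → ℤ)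
    (f : E → ℂ) : Prop where
  isRadSection : IsRadSection Φ η χ f
  transl : ∀ (x : E) (w : radSpace Φ η),
    f (x + w) = twistExp (hη.radTwist hχ) w * twistExp (hη.radFreq m) w * f x

/-- `e(2πi ρ_m(λ^K_n)) = 1`: integer frequencies are trivial on the lattice of `K(L)⁰`. [cite: Grafakos2014, §3.1.1] -/
theorem IsNSForm.twistExp_radFreq_latticeVec (hη : IsNSForm Φ η) (m n : Fin (subRank (nsRadical Φ η)) → ℤ) :
    twistExp (hη.radFreq m) (latticeVec hη.radPeriod n) = 1 :=
  twistExp_coordFunctional_intCast_latticeVec hη.radPeriod m n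

/-- The zero function is a pure mode of every frequency. [cite: Grafakos2014, Prop. 3.1.2 (1)] -/
theorem IsPureMode.zero {hη : IsNSForm Φ η} {hχ : IsSemicharacter Φ η χ} (m : Fin (subRank (nsRadical Φ η)) → ℤ) : IsPureMode hη hχ m (0 : E → ℂ) :=
  ⟨IsRadSection.zero, fun x w ↦ by simp⟩

/-- Scalar multiples of pure modes are pure modes. [cite: Grafakos2014, Prop. 3.1.2 (1)] -/
theorem IsPureMode.const_mul {hη : IsNSForm Φ η} {hχ : IsSemicharacter Φ η χ} {m : Fin (subRank (nsRadical Φ η)) → ℤ} {f : E → ℂ} (hf : IsPureMode hη hχ m f)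
    (c : ℂ) : IsPureMode hη hχ m (fun z ↦ c * f z) :=
  ⟨hf.isRadSection.const_mul c, fun x w ↦ by rw [hf.transl]; ring⟩

/-- A pure mode has constant modulus along the radical: `‖f(x + w)‖ = ‖f(x)‖`. [cite: Grafakos2014, Prop. 3.1.2 (6)] -/
theorem IsPureMode.norm_apply_add_coe {hη : IsNSForm Φ η} {hχ : IsSemicharacter Φ η χ} {m : Fin (subRank (nsRadical Φ η)) → ℤ} {f : E → ℂ}
    (hf : IsPureMode hη hχ m f) (x : E) (w : radSpace Φ η) : ‖f (x + w)‖ = ‖f x‖ := by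
  rw [hf.transl, norm_mul, norm_mul, norm_twistExp, norm_twistExp, one_mul, one_mul]

variable [FiniteDimensional ℂ E]

/-- **The `m`-th mode of a radical section is a pure mode of frequency `m`.**
[cite: Lange2023AbelianVarietiesComplex, §1.6.3 Prop. 1.6.10] [cite: Grafakos2014, Prop. 3.1.2 (6)] -/
theorem IsRadSection.isPureMode_radMode (hη : IsNSForm Φ η) (hχ : IsSemicharacter Φ η χ) {f : E → ℂ}
    (hf : IsRadSection Φ η χ f) (m : Fin (subRank (nsRadical Φ η)) → ℤ) :
    IsPureMode hη hχ m (hη.radMode hχ f m) := by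
  refine ⟨⟨hf.contDiff_radMode hη hχ m, fun n z ↦ ?_⟩, fun x w ↦ hf.radMode_add_coe hη hχ m x w⟩
  rw [← hη.coe_latticeVec_radPeriod, hf.radMode_add_coe hη hχ, hη.radChar_eq_twistExp hχ,
    hη.twistExp_radFreq_latticeVec, mul_one]

omit [FiniteDimensional ℂ E] in
/-- The characters of `K(L)⁰` along the section `radRepr`: `e(2πiρ_m(Ψ(repr y))) = e_m(y)`. [cite: Grafakos2014, §3.1.1] -/
theorem IsNSForm.twistExp_radFreq_radPeriod_radRepr (hη : IsNSForm Φ η) (m : Fin (subRank (nsRadical Φ η)) → ℤ)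
    (y : UnitAddTorus (Fin (subRank (nsRadical Φ η)))) :
    twistExp (hη.radFreq m) (hη.radPeriod (radRepr Φ η y)) = mFourier m y := by
  rw [← hη.mFourier_cover_radPeriod, cover_radPeriod_radRepr hη]

omit [FiniteDimensional ℂ E] in
/-- The kernel of a pure mode of frequency `m'` against `conj(e_m)` is the constant `f(x)` times `e_{m'} conj(e_m)`:
`A_f(x, repr y) conj(e_m(y)) = f(x) e_{m'}(y) conj(e_m(y))`. [cite: Grafakos2014, Prop. 3.1.2 (6)] -/
theorem IsPureMode.radKernel_mul_conj_mFourier {hη : IsNSForm Φ η} {hχ : IsSemicharacter Φ η χ} {m' : Fin (subRank (nsRadical Φ η)) → ℤ} {f : E → ℂ}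
    (hf : IsPureMode hη hχ m' f) (m : Fin (subRank (nsRadical Φ η)) → ℤ) (x : E)
    (y : UnitAddTorus (Fin (subRank (nsRadical Φ η)))) :
    hη.radKernel hχ f (x, radRepr Φ η y) * conj (mFourier m y) =
      f x * (conj (mFourier m y) * mFourier m' y) := by
  rw [IsNSForm.radKernel_apply, hf.transl, ← hη.twistExp_radFreq_radPeriod_radRepr m']
  have h1 := twistExp_neg_mul_self (hη.radTwist hχ) (hη.radPeriod (radRepr Φ η y))
  linear_combination (twistExp (hη.radFreq m') (hη.radPeriod (radRepr Φ η y)) * f x * conj (mFourier m y)) * h1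

omit [FiniteDimensional ℂ E] in
/-- **The modes of a convergent series of pure modes.** If `F = Σ_{m'} G_{m'}` pointwise with `G_{m'}` a pure mode
of frequency `m'`, the series converging absolutely at every point, and `F` is a radical section, then
`F^(m) = G_m` (orthonormality of the characters of `K(L)⁰`, the sum and the integral exchanged by dominated
convergence — `|G_{m'}(x + w)| = |G_{m'}(x)|`). [cite: Grafakos2014, Prop. 3.2.7] [cite: Grafakos2014, Prop. 3.1.2 (6)] -/
theorem IsRadSection.radMode_eq_of_hasSum (hη : IsNSForm Φ η) (hχ : IsSemicharacter Φ η χ) {F : E → ℂ}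
    (hF : IsRadSection Φ η χ F) {G : (Fin (subRank (nsRadical Φ η)) → ℤ) → E → ℂ}
    (hG : ∀ m', IsPureMode hη hχ m' (G m')) (hsum : ∀ x, Summable fun m' ↦ ‖G m' x‖)
    (heq : ∀ x, HasSum (fun m' ↦ G m' x) (F x)) (m : Fin (subRank (nsRadical Φ η)) → ℤ) (x : E) :
    hη.radMode hχ F m x = G m x := by
  classical
  set T := UnitAddTorus (Fin (subRank (nsRadical Φ η)))
  -- the integrand as a series of the pure-mode integrands
  have hker : ∀ y : T, hη.radKernel hχ F (x, radRepr Φ η y) * conj (mFourier m y) =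
      ∑' m', G m' x * (conj (mFourier m y) * mFourier m' y) := by
    intro y
    have hs : HasSum (fun m' ↦ hη.radKernel hχ (G m') (x, radRepr Φ η y) * conj (mFourier m y))
        (hη.radKernel hχ F (x, radRepr Φ η y) * conj (mFourier m y)) := by
      have h := ((heq (x + (hη.radPeriod (radRepr Φ η y) : E))).mul_left
        (twistExp (-hη.radTwist hχ) (hη.radPeriod (radRepr Φ η y)))).mul_right (conj (mFourier m y))
      exact h
    rw [← hs.tsum_eq]
    exact tsum_congr fun m' ↦ (hG m').radKernel_mul_conj_mFourier m x y
  -- exchange sum and integral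
  have hint : ∀ m', Integrable (fun y : T ↦ G m' x * (conj (mFourier m y) * mFourier m' y)) :=
    fun m' ↦ (continuous_const.mul ((continuous_conj.comp (mFourier m).continuous).mul
      (mFourier m').continuous)).integrable_unitAddTorus
  have hnorm : ∀ m' (y : T), ‖G m' x * (conj (mFourier m y) * mFourier m' y)‖ = ‖G m' x‖ := by
    intro m' y
    rw [norm_mul, norm_mul, Complex.norm_conj, Torus.norm_mFourier_apply, Torus.norm_mFourier_apply, mul_one,
      mul_one]
  have hsum' : Summable fun m' ↦ ∫ y : T, ‖G m' x * (conj (mFourier m y) * mFourier m' y)‖ := by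
    simp only [hnorm, integral_const, smul_eq_mul, probReal_univ, one_mul]
    exact hsum x
  rw [hF.radMode_eq_integral hη hχ m x]
  simp_rw [hker]
  rw [← integral_tsum_of_summable_integral_norm hint hsum']
  have hI : ∀ m', ∫ y : T, G m' x * (conj (mFourier m y) * mFourier m' y) = G m' x * (if m = m' then 1 else 0) := by
    intro m'
    rw [integral_const_mul, Torus.integral_conj_mFourier_mul_mFourier]
  rw [tsum_congr hI, tsum_eq_single m (fun m' hm' ↦ by rw [if_neg (Ne.symm hm'), mul_zero]), if_pos rfl, mul_one]

omit [FiniteDimensional ℂ E] in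
/-- **The modes of a pure mode**: `f^(m) = [m = m'] f` for a pure mode `f` of frequency `m'`.
[cite: Grafakos2014, Prop. 3.2.7] -/
theorem IsPureMode.radMode_eq_ite {hη : IsNSForm Φ η} {hχ : IsSemicharacter Φ η χ} {m' : Fin (subRank (nsRadical Φ η)) → ℤ} {f : E → ℂ} (hf : IsPureMode hη hχ m' f)
    (m : Fin (subRank (nsRadical Φ η)) → ℤ) (x : E) :
    hη.radMode hχ f m x = if m = m' then f x else 0 := by
  classical
  have h := hf.isRadSection.radMode_eq_of_hasSum hη hχ (G := fun n z ↦ if n = m' then f z else 0)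
    (fun n ↦ by
      by_cases hn : n = m'
      · simp only [hn, if_true]; exact hf
      · simp only [hn, if_false]; exact IsPureMode.zero n)
    (fun z ↦ summable_of_ne_finset_zero (s := {m'}) (fun n hn ↦ by
      rw [Finset.mem_singleton] at hn; simp [hn]))
    (fun z ↦ hasSum_ite_eq m' (f z)) m x
  simpa using h

/-- The modes of a mode: `(f^(m'))^(m) = [m = m'] f^(m')`. [cite: Grafakos2014, Prop. 3.2.7] -/
theorem IsRadSection.radMode_radMode (hη : IsNSForm Φ η) (hχ : IsSemicharacter Φ η χ) {f : E → ℂ}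
    (hf : IsRadSection Φ η χ f) (m m' : Fin (subRank (nsRadical Φ η)) → ℤ) (x : E) :
    hη.radMode hχ (hη.radMode hχ f m') m x = if m = m' then hη.radMode hχ f m' x else 0 :=
  (hf.isPureMode_radMode hη hχ m').radMode_eq_ite m x

omit [DecidableEq ι] [FiniteDimensional ℂ E] in
/-- Negatives of radical sections. [cite: Lange2023AbelianVarietiesComplex, §1.6.3 Prop. 1.6.10 (Step 1)] -/
theorem IsRadSection.neg {f : E → ℂ} (hf : IsRadSection Φ η χ f) : IsRadSection Φ η χ (-f) := by
  have h := hf.const_mul (-1)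
  simp only [neg_mul, one_mul] at h
  exact h

omit [DecidableEq ι] [FiniteDimensional ℂ E] in
/-- Differences of radical sections. [cite: Lange2023AbelianVarietiesComplex, §1.6.3 Prop. 1.6.10 (Step 1)] -/
theorem IsRadSection.sub {f g : E → ℂ} (hf : IsRadSection Φ η χ f) (hg : IsRadSection Φ η χ g) :
    IsRadSection Φ η χ (f - g) := by
  rw [sub_eq_add_neg]; exact hf.add hg.neg

omit [FiniteDimensional ℂ E] in
/-- **Two radical sections with the same modes are equal** (uniqueness of Fourier coefficients, slice by slice).
[cite: Grafakos2014, Prop. 3.2.4] -/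
theorem IsRadSection.eq_of_forall_radMode_eq (hη : IsNSForm Φ η) (hχ : IsSemicharacter Φ η χ) {f g : E → ℂ}
    (hf : IsRadSection Φ η χ f) (hg : IsRadSection Φ η χ g)
    (h : ∀ m x, hη.radMode hχ f m x = hη.radMode hχ g m x) : f = g := by
  have hfg := hf.sub hg
  have h0 : f - g = 0 := hfg.eq_zero_of_forall_radMode_eq_zero hη hχ fun m x ↦ by
    rw [sub_eq_add_neg, hf.radMode_add hη hχ hg.neg, show (-g) = fun z ↦ (-1 : ℂ) * g z by funext z; simp,
      hη.radMode_const_mul hχ, h]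
    ring
  exact sub_eq_zero.1 h0

/-- **A uniform bound for the modes at a point**: `‖f^(m)(x)‖ ≤ C_x` for all `m` (`|∫ A_f(x, ·) conj(e_m)| ≤ sup|A_f(x, ·)|`
over the unit cube). [cite: Grafakos2014, Prop. 3.2.5 (3.2.1)] -/
theorem IsRadSection.exists_forall_norm_radMode_le (hη : IsNSForm Φ η) (hχ : IsSemicharacter Φ η χ) {f : E → ℂ}
    (hf : IsRadSection Φ η χ f) (x : E) :
    ∃ C : ℝ, 0 ≤ C ∧ ∀ m, ‖hη.radMode hχ f m x‖ ≤ C := by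
  obtain ⟨C, hC0, hC⟩ := Literature.Analysis.Calculus.exists_forall_norm_le_of_continuous_prod
    (hη.contDiff_radKernel hχ hf.contDiff).continuous x 0 1
  refine ⟨C, hC0, fun m ↦ ?_⟩
  rw [hf.radMode_eq_integral hη hχ m x]
  have hle : ∀ y : UnitAddTorus (Fin (subRank (nsRadical Φ η))),
      ‖hη.radKernel hχ f (x, radRepr Φ η y) * conj (mFourier m y)‖ ≤ C := fun y ↦ by
    rw [norm_mul, Complex.norm_conj, Torus.norm_mFourier_apply, mul_one]
    exact hC x (Metric.mem_closedBall_self le_rfl) _ (mem_closedBall_zero_iff.2 (norm_radRepr_le y))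
  have h := norm_integral_le_of_norm_le_const (μ := volume) (Filter.Eventually.of_forall hle)
  rwa [probReal_univ, mul_one] at h

end PureMode

/-! ## §2 Mode multipliers `T_a f = Σ_m a_m f^(m)`, `a ∈ ℓ¹`: kernel integral, smoothness, modes, sections of `L`,
commutation with `∂̄_u`, `∂_u`, `H(u, ·)·`, `δ̄_u` -/

section Multiplier

variable {ι : Type*} [Fintype ι] [DecidableEq ι] {E : Type*} [NormedAddCommGroup E] [NormedSpace ℂ E]
  {Φ : (ι → ℝ) ≃L[ℝ] E} {η : E [⋀^Fin 2]→L[ℝ] ℝ} {χ : (ι → ℤ) → ℂ}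
  (hη : IsNSForm Φ η) (hχ : IsSemicharacter Φ η χ)

variable (Φ η) in
/-- **The kernel `K_a = Σ_m a_m conj(e_m)` on `K(L)⁰`** of the multiplier with symbol `a ∈ ℓ¹` (an absolutely and
uniformly convergent series of characters, hence continuous). [cite: Grafakos2014, Prop. 3.2.5] -/
def radMulKernel (a : (Fin (subRank (nsRadical Φ η)) → ℤ) → ℂ)
    (y : UnitAddTorus (Fin (subRank (nsRadical Φ η)))) : ℂ :=
  ∑' m, a m * conj (mFourier m y)

/-- **The mode multiplier `T_a f = Σ_m a_m f^(m)`** with symbol `a` (a Fourier multiplier of the torus `K(L)⁰`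
acting on the radical sections of `L` slice by slice). [cite: Grafakos2014, Prop. 3.2.5] [cite: Lange2023AbelianVarietiesComplex, §1.6.3 Prop. 1.6.10] -/
def IsNSForm.radMul (a : (Fin (subRank (nsRadical Φ η)) → ℤ) → ℂ) (f : E → ℂ) (x : E) : ℂ :=
  ∑' m, a m * hη.radMode hχ f m x

/-- Unfolding of `radMul`. [cite: Grafakos2014, Prop. 3.2.5] -/
theorem IsNSForm.radMul_apply (a : (Fin (subRank (nsRadical Φ η)) → ℤ) → ℂ) (f : E → ℂ) (x : E) :
    hη.radMul hχ a f x = ∑' m, a m * hη.radMode hχ f m x := rfl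

omit [DecidableEq ι] in
/-- The kernel is continuous for `a ∈ ℓ¹`. [cite: Grafakos2014, Prop. 3.2.5] -/
theorem continuous_radMulKernel {a : (Fin (subRank (nsRadical Φ η)) → ℤ) → ℂ} (ha : Summable fun m ↦ ‖a m‖) :
    Continuous (radMulKernel Φ η a) := by
  refine continuous_tsum (fun m ↦ continuous_const.mul (continuous_conj.comp (mFourier m).continuous)) ha
    fun m y ↦ ?_
  rw [norm_mul, Complex.norm_conj, Torus.norm_mFourier_apply, mul_one]

omit [DecidableEq ι] in
/-- The kernel is integrable on `K(L)⁰`. [cite: Grafakos2014, Prop. 3.2.5] -/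
theorem integrable_radMulKernel {a : (Fin (subRank (nsRadical Φ η)) → ℤ) → ℂ} (ha : Summable fun m ↦ ‖a m‖) :
    Integrable (radMulKernel Φ η a) (volume : Measure (UnitAddTorus (Fin (subRank (nsRadical Φ η))))) :=
  (continuous_radMulKernel ha).integrable_unitAddTorus

section Basic

variable {a : (Fin (subRank (nsRadical Φ η)) → ℤ) → ℂ} (ha : Summable fun m ↦ ‖a m‖)
include ha

/-- The series `Σ_m a_m f^(m)(x)` converges absolutely. [cite: Grafakos2014, Prop. 3.2.5] -/
theorem IsRadSection.summable_norm_radMul_term [FiniteDimensional ℂ E] {f : E → ℂ} (hf : IsRadSection Φ η χ f) (x : E) :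
    Summable fun m ↦ ‖a m * hη.radMode hχ f m x‖ := by
  obtain ⟨C, hC0, hC⟩ := hf.exists_forall_norm_radMode_le hη hχ x
  refine Summable.of_nonneg_of_le (fun m ↦ norm_nonneg _) (fun m ↦ ?_) (ha.mul_right C)
  rw [norm_mul]
  exact mul_le_mul_of_nonneg_left (hC m) (norm_nonneg _)

/-- `T_a f(x) = Σ_m a_m f^(m)(x)` as a `HasSum`. [cite: Grafakos2014, Prop. 3.2.5] -/
theorem IsRadSection.hasSum_radMul [FiniteDimensional ℂ E] {f : E → ℂ} (hf : IsRadSection Φ η χ f) (x : E) :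
    HasSum (fun m ↦ a m * hη.radMode hχ f m x) (hη.radMul hχ a f x) :=
  (hf.summable_norm_radMul_term hη hχ ha x).of_norm.hasSum

/-- **`T_a f` as an integral over `K(L)⁰` against the smooth kernel of FILE 1 and `K_a`**:
`T_a f(x) = ∫_{K(L)⁰} A_f(x, s_y) K_a(y) dy`. [cite: Grafakos2014, Prop. 3.2.5] [cite: Grafakos2014, §3.1.1 (3.1.4)] -/
theorem IsRadSection.radMul_eq_integral [FiniteDimensional ℂ E] {f : E → ℂ} (hf : IsRadSection Φ η χ f) (x : E) :
    hη.radMul hχ a f x = ∫ y : UnitAddTorus (Fin (subRank (nsRadical Φ η))),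
      hη.radKernel hχ f (x, radRepr Φ η y) * radMulKernel Φ η a y := by
  set T := UnitAddTorus (Fin (subRank (nsRadical Φ η)))
  obtain ⟨C, hC0, hC⟩ := Literature.Analysis.Calculus.exists_forall_norm_le_of_continuous_prod
    (hη.contDiff_radKernel hχ hf.contDiff).continuous x 0 1
  have hK : ∀ y : T, ‖hη.radKernel hχ f (x, radRepr Φ η y)‖ ≤ C := fun y ↦
    hC x (Metric.mem_closedBall_self le_rfl) _ (mem_closedBall_zero_iff.2 (norm_radRepr_le y))
  have hKm : AEStronglyMeasurable (fun y : T ↦ hη.radKernel hχ f (x, radRepr Φ η y)) volume :=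
    (hη.contDiff_radKernel hχ hf.contDiff).continuous.comp_aestronglyMeasurable
      (aestronglyMeasurable_const.prodMk measurable_radRepr.aestronglyMeasurable)
  have hint : ∀ m, Integrable (fun y : T ↦ hη.radKernel hχ f (x, radRepr Φ η y) * (a m * conj (mFourier m y))) := by
    intro m
    refine Integrable.bdd_mul (c := C) ((continuous_const.mul (continuous_conj.comp
      (mFourier m).continuous)).integrable_unitAddTorus) hKm (Filter.Eventually.of_forall hK)
  have hsum' : Summable fun m ↦ ∫ y : T, ‖hη.radKernel hχ f (x, radRepr Φ η y) * (a m * conj (mFourier m y))‖ := by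
    refine Summable.of_nonneg_of_le (fun m ↦ integral_nonneg fun y ↦ norm_nonneg _) (fun m ↦ ?_) (ha.mul_left C)
    have hle : ∀ y : T, ‖hη.radKernel hχ f (x, radRepr Φ η y) * (a m * conj (mFourier m y))‖ ≤ C * ‖a m‖ := by
      intro y
      rw [norm_mul, norm_mul, Complex.norm_conj, Torus.norm_mFourier_apply, mul_one]
      exact mul_le_mul_of_nonneg_right (hK y) (norm_nonneg _)
    have h := integral_mono_of_nonneg (μ := (volume : Measure T)) (Filter.Eventually.of_forall fun y ↦ norm_nonneg _)
      (integrable_const (C * ‖a m‖)) (Filter.Eventually.of_forall hle)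
    rwa [integral_const, smul_eq_mul, probReal_univ, one_mul] at h
  have hrhs : (fun y : T ↦ hη.radKernel hχ f (x, radRepr Φ η y) * radMulKernel Φ η a y) =
      fun y ↦ ∑' m, hη.radKernel hχ f (x, radRepr Φ η y) * (a m * conj (mFourier m y)) := by
    funext y; rw [radMulKernel, tsum_mul_left]
  rw [hrhs, ← integral_tsum_of_summable_integral_norm hint hsum', IsNSForm.radMul_apply]
  refine tsum_congr fun m ↦ ?_
  rw [hf.radMode_eq_integral hη hχ m x, ← integral_const_mul]
  refine integral_congr_ae (Filter.Eventually.of_forall fun y ↦ ?_)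
  simp only
  ring

/-- The same, as functions of `x`. [cite: Grafakos2014, Prop. 3.2.5] -/
theorem IsRadSection.radMul_eq [FiniteDimensional ℂ E] {f : E → ℂ} (hf : IsRadSection Φ η χ f) :
    hη.radMul hχ a f = fun x ↦ ∫ y : UnitAddTorus (Fin (subRank (nsRadical Φ η))),
      hη.radKernel hχ f (x, radRepr Φ η y) * radMulKernel Φ η a y :=
  funext (hf.radMul_eq_integral hη hχ ha)

/-- **`T_a f` is `C^∞`** (differentiation under the integral sign against the smooth kernel, tree
`Literature.Analysis.Calculus.contDiff_integral_kernel_mul`). [cite: Grafakos2014, Prop. 3.2.5] -/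
theorem IsRadSection.contDiff_radMul [FiniteDimensional ℂ E] {f : E → ℂ} (hf : IsRadSection Φ η χ f) :
    ContDiff ℝ ∞ (hη.radMul hχ a f) := by
  rw [hf.radMul_eq hη hχ ha]
  exact Literature.Analysis.Calculus.contDiff_integral_kernel_mul (hη.contDiff_radKernel hχ hf.contDiff)
    measurable_radRepr.aestronglyMeasurable (Filter.Eventually.of_forall norm_radRepr_le)
    (integrable_radMulKernel ha)

/-- **`T_a f` is a radical section** (quasi-periodicity under `Λ_0` term by term).
[cite: Lange2023AbelianVarietiesComplex, §1.6.3 Prop. 1.6.10 (Step 1)] -/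
theorem IsRadSection.radMul [FiniteDimensional ℂ E] {f : E → ℂ} (hf : IsRadSection Φ η χ f) :
    IsRadSection Φ η χ (hη.radMul hχ a f) := by
  refine ⟨hf.contDiff_radMul hη hχ ha, fun n z ↦ ?_⟩
  rw [IsNSForm.radMul_apply, IsNSForm.radMul_apply, ← tsum_mul_left]
  refine tsum_congr fun m ↦ ?_
  rw [(hf.isPureMode_radMode hη hχ m).isRadSection.periodic]
  ring

/-- **The modes of `T_a f` are `a_m f^(m)`.** [cite: Grafakos2014, Prop. 3.2.5] [cite: Grafakos2014, Prop. 3.2.7] -/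
theorem IsRadSection.radMode_radMul [FiniteDimensional ℂ E] {f : E → ℂ} (hf : IsRadSection Φ η χ f)
    (m : Fin (subRank (nsRadical Φ η)) → ℤ) (x : E) :
    hη.radMode hχ (hη.radMul hχ a f) m x = a m * hη.radMode hχ f m x :=
  (hf.radMul hη hχ ha).radMode_eq_of_hasSum hη hχ (G := fun m z ↦ a m * hη.radMode hχ f m z)
    (fun m' ↦ (hf.isPureMode_radMode hη hχ m').const_mul (a m')) (hf.summable_norm_radMul_term hη hχ ha)
    (hf.hasSum_radMul hη hχ ha) m x

/-- **`T_a` maps smooth sections of `L` to smooth sections of `L`** (every mode is one, FILE 1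
`radMode_mem_smoothTheta`, and the quasi-periodicity passes to the sum).
[cite: Lange2023AbelianVarietiesComplex, §1.6.3 Prop. 1.6.10 (Step 1)] -/
theorem IsNSForm.radMul_mem_smoothTheta [FiniteDimensional ℂ E] {f : E → ℂ} (hf : f ∈ smoothTheta Φ (canonicalFactor Φ η χ)) :
    hη.radMul hχ a f ∈ smoothTheta Φ (canonicalFactor Φ η χ) := by
  have hf' := IsRadSection.of_mem_smoothTheta hη.type_one_one hf
  refine ⟨hf'.contDiff_radMul hη hχ ha, fun n z ↦ ?_⟩
  rw [IsNSForm.radMul_apply, IsNSForm.radMul_apply, ← tsum_mul_left]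
  refine tsum_congr fun m ↦ ?_
  rw [(hη.radMode_mem_smoothTheta hχ hf m).2]
  ring

omit ha in
/-- `T_a 0 = 0`. [cite: Grafakos2014, Prop. 3.1.2 (1)] -/
theorem IsNSForm.radMul_zero : hη.radMul hχ a (0 : E → ℂ) = 0 := by
  funext x
  rw [IsNSForm.radMul_apply, Pi.zero_apply]
  have h0 : ∀ m, hη.radMode hχ (0 : E → ℂ) m x = 0 := fun m ↦ by
    have h := hη.radMode_const_mul hχ 0 (fun _ : E ↦ (0 : ℂ)) m x
    simp only [zero_mul] at h
    exact h
  simp [h0]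

/-- `T_a` is additive on radical sections. [cite: Grafakos2014, Prop. 3.1.2 (1)] -/
theorem IsRadSection.radMul_add [FiniteDimensional ℂ E] {f g : E → ℂ} (hf : IsRadSection Φ η χ f)
    (hg : IsRadSection Φ η χ g) : hη.radMul hχ a (f + g) = hη.radMul hχ a f + hη.radMul hχ a g := by
  funext x
  rw [Pi.add_apply, IsNSForm.radMul_apply, IsNSForm.radMul_apply, IsNSForm.radMul_apply,
    ← (hf.summable_norm_radMul_term hη hχ ha x).of_norm.tsum_add (hg.summable_norm_radMul_term hη hχ ha x).of_norm]
  refine tsum_congr fun m ↦ ?_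
  rw [hf.radMode_add hη hχ hg]
  ring

omit ha in
/-- `T_a` is homogeneous. [cite: Grafakos2014, Prop. 3.1.2 (1)] -/
theorem IsNSForm.radMul_const_mul (c : ℂ) (f : E → ℂ) :
    hη.radMul hχ a (fun z ↦ c * f z) = fun z ↦ c * hη.radMul hχ a f z := by
  funext x
  rw [IsNSForm.radMul_apply, IsNSForm.radMul_apply, ← tsum_mul_left]
  refine tsum_congr fun m ↦ ?_
  rw [hη.radMode_const_mul hχ]
  ring

/-- `T_a` through finite sums of radical sections. [cite: Grafakos2014, Prop. 3.1.2 (1)] -/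
theorem IsNSForm.radMul_finset_sum [FiniteDimensional ℂ E] {α : Type*} (s : Finset α) {F : α → E → ℂ} (hF : ∀ i ∈ s, IsRadSection Φ η χ (F i)) :
    hη.radMul hχ a (fun z ↦ ∑ i ∈ s, F i z) = fun z ↦ ∑ i ∈ s, hη.radMul hχ a (F i) z := by
  classical
  induction s using Finset.induction_on with
  | empty =>
    simp only [Finset.sum_empty]
    exact hη.radMul_zero hχ
  | insert i s hi ih =>
    have hF' : ∀ j ∈ s, IsRadSection Φ η χ (F j) := fun j hj ↦ hF j (Finset.mem_insert_of_mem hj)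
    simp only [Finset.sum_insert hi]
    rw [show (fun z ↦ F i z + ∑ j ∈ s, F j z) = F i + fun z ↦ ∑ j ∈ s, F j z from rfl,
      (hF i (Finset.mem_insert_self i s)).radMul_add hη hχ ha (IsRadSection.finset_sum s hF'), ih hF']
    rfl

/-! ### Commutation with the first-order operators (via the modes) -/

variable [FiniteDimensional ℂ E]

/-- **`T_a ∂̄_u = ∂̄_u T_a`** on radical sections, for every `u ∈ V`. [cite: Grafakos2014, Prop. 3.1.2 (8)] -/
theorem IsRadSection.dbarAlong_radMul {f : E → ℂ} (hf : IsRadSection Φ η χ f) (u : E) :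
    dbarAlong u (hη.radMul hχ a f) = hη.radMul hχ a (dbarAlong u f) := by
  have h1 := isRadSection_dbarAlong (hf.radMul hη hχ ha) u
  have h2 := (isRadSection_dbarAlong hf u).radMul hη hχ ha
  refine h1.eq_of_forall_radMode_eq hη hχ h2 fun m x ↦ ?_
  rw [← (hf.radMul hη hχ ha).dbarAlong_radMode hη hχ, (isRadSection_dbarAlong hf u).radMode_radMul hη hχ ha,
    ← hf.dbarAlong_radMode hη hχ]
  have hfun : hη.radMode hχ (hη.radMul hχ a f) m = fun y ↦ a m * hη.radMode hχ f m y :=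
    funext fun y ↦ hf.radMode_radMul hη hχ ha m y
  rw [hfun, Literature.Analysis.Pluripotential.dbarAlong_const_mul
    (((hf.contDiff_radMode hη hχ m).differentiable (by simp)) x)]

/-- **`T_a ∂_u = ∂_u T_a`** on radical sections. [cite: Grafakos2014, Prop. 3.1.2 (8)] -/
theorem IsRadSection.delAlong_radMul {f : E → ℂ} (hf : IsRadSection Φ η χ f) (u : E) :
    delAlong u (hη.radMul hχ a f) = hη.radMul hχ a (delAlong u f) := by
  have h1 := isRadSection_delAlong (hf.radMul hη hχ ha) u
  have h2 := (isRadSection_delAlong hf u).radMul hη hχ ha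
  refine h1.eq_of_forall_radMode_eq hη hχ h2 fun m x ↦ ?_
  rw [← (hf.radMul hη hχ ha).delAlong_radMode hη hχ, (isRadSection_delAlong hf u).radMode_radMul hη hχ ha,
    ← hf.delAlong_radMode hη hχ]
  have hfun : hη.radMode hχ (hη.radMul hχ a f) m = fun y ↦ a m * hη.radMode hχ f m y :=
    funext fun y ↦ hf.radMode_radMul hη hχ ha m y
  rw [hfun, delAlong_const_mul (((hf.contDiff_radMode hη hχ m).differentiable (by simp)) x)]

/-- **`T_a (H(u, ·) f) = H(u, ·) T_a f`.** [cite: Lange2023AbelianVarietiesComplex, §1.6.1 Lemma 1.6.2] -/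
theorem IsRadSection.hermOf_mul_radMul {f : E → ℂ} (hf : IsRadSection Φ η χ f) (u : E) :
    (fun z ↦ hermOf η u z * hη.radMul hχ a f z) = hη.radMul hχ a (fun z ↦ hermOf η u z * f z) := by
  have h1 := (hf.radMul hη hχ ha).hermOf_mul hη u
  have h2 := (hf.hermOf_mul hη u).radMul hη hχ ha
  refine h1.eq_of_forall_radMode_eq hη hχ h2 fun m x ↦ ?_
  rw [hη.radMode_hermOf_mul hχ, (hf.hermOf_mul hη u).radMode_radMul hη hχ ha, hf.radMode_radMul hη hχ ha,
    hη.radMode_hermOf_mul hχ]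
  ring

/-- **`T_a δ̄_u = δ̄_u T_a`** on radical sections, for every `u ∈ V` (`δ̄_u = -∂_u + π H(u, ·)`).
[cite: Lange2023AbelianVarietiesComplex, §1.6.1 Lemma 1.6.2] -/
theorem IsRadSection.deltaBar_radMul {f : E → ℂ} (hf : IsRadSection Φ η χ f) (u : E) :
    deltaBar η u (hη.radMul hχ a f) = hη.radMul hχ a (deltaBar η u f) := by
  have hsplit : ∀ g : E → ℂ, deltaBar η u g =
      (fun z ↦ (-1 : ℂ) * delAlong u g z) + fun z ↦ hermOf η u z * ((π : ℂ) * g z) := by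
    intro g; funext z; rw [Pi.add_apply, deltaBar_apply]; ring
  rw [hsplit, hsplit, ((isRadSection_delAlong hf u).const_mul (-1)).radMul_add hη hχ ha ((hf.const_mul π).hermOf_mul hη u),
    hη.radMul_const_mul hχ, ← (hf.const_mul π).hermOf_mul_radMul hη hχ ha, hη.radMul_const_mul hχ, hf.delAlong_radMul hη hχ ha]

end Basic

end Multiplier

/-! ## §3 The radical frame `(e_ν)_{ν ∈ Z}`, the radical Laplacian `L_Z = Σ_{ν∈Z} k_ν⁻¹ δ̄_ν ∂̄_ν`, its symbol
`μ_m` on the modes, the vacuum mode and the vacuum part `P₀` -/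

section Radical

variable {ι : Type*} [Fintype ι] [DecidableEq ι] {E : Type*} [NormedAddCommGroup E] [NormedSpace ℂ E]
  {Φ : (ι → ℝ) ≃L[ℝ] E} {η : E [⋀^Fin 2]→L[ℝ] ℝ} {χ : (ι → ℤ) → ℂ} {g : ℕ} {b : Fin g → E} {Z : Finset (Fin g)}

/-- **The radical frame**: `e_ν` for `ν ∈ Z` (as vectors of `Φ(Λ(L)⁰)`), `0` for `ν ∉ Z` — Lange's
`Λ(L)⁰ = ⟨e_{r+s+1}, …, e_g⟩_ℂ` of (1.29), kept on the index set of the full frame.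
[cite: Lange2023AbelianVarietiesComplex, §1.6.3 (1.29)] -/
def radFrame (hZ : ∀ ν ∈ Z, b ν ∈ radSpace Φ η) (ν : Fin g) : radSpace Φ η :=
  if h : ν ∈ Z then ⟨b ν, hZ ν h⟩ else 0

omit [Fintype ι] [DecidableEq ι] in
/-- `radFrame ν = e_ν` for `ν ∈ Z`. [cite: Lange2023AbelianVarietiesComplex, §1.6.3 (1.29)] -/
theorem coe_radFrame_of_mem (hZ : ∀ ν ∈ Z, b ν ∈ radSpace Φ η) {ν : Fin g} (hν : ν ∈ Z) :
    (radFrame hZ ν : E) = b ν := by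
  simp [radFrame, hν]

omit [Fintype ι] [DecidableEq ι] in
/-- `radFrame ν = 0` for `ν ∉ Z`. [cite: Lange2023AbelianVarietiesComplex, §1.6.3 (1.29)] -/
theorem radFrame_of_not_mem (hZ : ∀ ν ∈ Z, b ν ∈ radSpace Φ η) {ν : Fin g} (hν : ν ∉ Z) : radFrame hZ ν = 0 := by
  simp [radFrame, hν]

omit [Fintype ι] [DecidableEq ι] in
/-- `radFrame ν = Z.piecewise b 0 ν` in `V`. [cite: Lange2023AbelianVarietiesComplex, §1.6.3 (1.29)] -/
theorem coe_radFrame (hZ : ∀ ν ∈ Z, b ν ∈ radSpace Φ η) (ν : Fin g) :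
    (radFrame hZ ν : E) = if ν ∈ Z then b ν else 0 := by
  by_cases hν : ν ∈ Z
  · rw [coe_radFrame_of_mem hZ hν, if_pos hν]
  · rw [radFrame_of_not_mem hZ hν, if_neg hν, Submodule.coe_zero]

/-- `∂̄_0 = 0`. [cite: Lange2023AbelianVarietiesComplex, §1.6.1 p0064] -/
theorem dbarAlong_zero_dir (u : E → ℂ) (x : E) : dbarAlong (0 : E) u x = 0 := by
  rw [dbarAlong_apply]; simp

/-- **The radical Laplacian `L_Z f = Σ_{ν ∈ Z} k_ν⁻¹ δ̄_{e_ν} ∂̄_{e_ν} f`** — the `Λ(L)⁰`-part of the scalar operator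
`Δ_I` of Prop. 1.6.3 (the same for every `I`, the curvature terms `h_ν = H(e_ν, e_ν)` vanishing on `Z`).
[cite: Lange2023AbelianVarietiesComplex, §1.6.1 Prop. 1.6.3] -/
def radLaplace (η : E [⋀^Fin 2]→L[ℝ] ℝ) (b : Fin g → E) (Z : Finset (Fin g)) (k : Fin g → ℝ) (f : E → ℂ) (x : E) : ℂ :=
  ∑ ν ∈ Z, ((k ν)⁻¹ : ℝ) * deltaBar η (b ν) (dbarAlong (b ν) f) x

/-- Unfolding of `radLaplace`. [cite: Lange2023AbelianVarietiesComplex, §1.6.1 Prop. 1.6.3] -/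
theorem radLaplace_apply (η : E [⋀^Fin 2]→L[ℝ] ℝ) (b : Fin g → E) (Z : Finset (Fin g)) (k : Fin g → ℝ)
    (f : E → ℂ) (x : E) :
    radLaplace η b Z k f x = ∑ ν ∈ Z, ((k ν)⁻¹ : ℝ) * deltaBar η (b ν) (dbarAlong (b ν) f) x := rfl

omit [Fintype ι] [DecidableEq ι] in
/-- `L_Z` in terms of the radical frame on the full index set: `L_Z f = Σ_ν k_ν⁻¹ δ̄_{e'_ν} ∂̄_{e_ν} f` with
`e' = radFrame` (the terms off `Z` vanish, `δ̄_0 = 0`). [cite: Lange2023AbelianVarietiesComplex, §1.6.1 Prop. 1.6.3] -/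
theorem radLaplace_eq_sum_radFrame (η : E [⋀^Fin 2]→L[ℝ] ℝ) (k : Fin g → ℝ) (hZ : ∀ ν ∈ Z, b ν ∈ radSpace Φ η)
    (f : E → ℂ) (x : E) :
    radLaplace η b Z k f x = ∑ ν, ((k ν)⁻¹ : ℝ) * deltaBar η (radFrame hZ ν : E) (dbarAlong (b ν) f) x := by
  classical
  rw [radLaplace_apply η b Z k, ← Finset.sum_filter_add_sum_filter_not Finset.univ (· ∈ Z)]
  have h1 : Finset.univ.filter (· ∈ Z) = Z := by ext ν; simp
  rw [h1, Finset.sum_eq_zero (s := Finset.univ.filter (· ∉ Z)) fun ν hν ↦ by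
    rw [radFrame_of_not_mem hZ (Finset.mem_filter.1 hν).2, Submodule.coe_zero, deltaBar_zero_left, mul_zero], add_zero]
  exact Finset.sum_congr rfl fun ν hν ↦ by rw [coe_radFrame_of_mem hZ hν]

variable (hη : IsNSForm Φ η) (hχ : IsSemicharacter Φ η χ) {k : Fin g → ℝ}

omit [DecidableEq ι] in
include hη in
/-- `L_Z` preserves radical sections. [cite: Lange2023AbelianVarietiesComplex, §1.6.1 Prop. 1.6.3] -/
theorem isRadSection_radLaplace {f : E → ℂ} (hf : IsRadSection Φ η χ f) :
    IsRadSection Φ η χ (radLaplace η b Z k f) := by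
  refine IsRadSection.finset_sum Z fun ν _ ↦ IsRadSection.const_mul ?_ _
  have h1 := isRadSection_dbarAlong hf (b ν)
  have h : deltaBar η (b ν) (dbarAlong (b ν) f) =
      (fun z ↦ (-1 : ℂ) * delAlong (b ν) (dbarAlong (b ν) f) z) +
        fun z ↦ hermOf η (b ν) z * ((π : ℂ) * dbarAlong (b ν) f z) := by
    funext z; rw [Pi.add_apply, deltaBar_apply]; ring
  rw [h]
  exact ((isRadSection_delAlong h1 _).const_mul _).add ((h1.const_mul _).hermOf_mul hη _)

omit [Fintype ι] [DecidableEq ι] in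
include hη hχ in
/-- `L_Z` preserves `A^{0,0}(L)`. [cite: Lange2023AbelianVarietiesComplex, §1.6.1 Prop. 1.6.3] -/
theorem IsNSForm.radLaplace_mem_smoothTheta {f : E → ℂ}
    (hf : f ∈ smoothTheta Φ (canonicalFactor Φ η χ)) :
    radLaplace η b Z k f ∈ smoothTheta Φ (canonicalFactor Φ η χ) := by
  have he := isFactor_canonicalFactor Φ hη hχ
  have h : radLaplace η b Z k f = ∑ ν ∈ Z, (((k ν)⁻¹ : ℝ) : ℂ) • deltaBar η (b ν) (dbarAlong (b ν) f) := by
    funext x; simp [radLaplace_apply, Finset.sum_apply, smul_eq_mul]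
  rw [h]
  exact Submodule.sum_mem _ fun ν _ ↦ Submodule.smul_mem _ _
    (deltaBar_mem_smoothTheta hη (dbarAlong_mem_smoothTheta he hf _) _)

/-- **`L_Z` commutes with taking modes.** [cite: Lange2023AbelianVarietiesComplex, §1.6.1 Prop. 1.6.3] -/
theorem IsRadSection.radMode_radLaplace [FiniteDimensional ℂ E] {f : E → ℂ} (hf : IsRadSection Φ η χ f)
    (m : Fin (subRank (nsRadical Φ η)) → ℤ) (x : E) :
    hη.radMode hχ (radLaplace η b Z k f) m x = radLaplace η b Z k (hη.radMode hχ f m) x := by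
  have hterm : ∀ ν ∈ Z, IsRadSection Φ η χ (fun z ↦ (((k ν)⁻¹ : ℝ) : ℂ) * deltaBar η (b ν) (dbarAlong (b ν) f) z) := by
    intro ν _
    have h := isRadSection_radLaplace hη (b := b) (Z := {ν}) (k := k) hf
    have e : radLaplace η b {ν} k f = fun z ↦ (((k ν)⁻¹ : ℝ) : ℂ) * deltaBar η (b ν) (dbarAlong (b ν) f) z := by
      funext z; rw [radLaplace_apply, Finset.sum_singleton]
    rwa [e] at h
  rw [show radLaplace η b Z k f = fun z ↦ ∑ ν ∈ Z, (((k ν)⁻¹ : ℝ) : ℂ) * deltaBar η (b ν) (dbarAlong (b ν) f) z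
    from funext fun z ↦ radLaplace_apply η b Z k f z, hη.radMode_finset_sum hχ Z hterm, radLaplace_apply η b Z k]
  refine Finset.sum_congr rfl fun ν _ ↦ ?_
  rw [hη.radMode_const_mul hχ, ← (isRadSection_dbarAlong hf (b ν)).deltaBar_radMode hη hχ,
    show hη.radMode hχ (dbarAlong (b ν) f) m = dbarAlong (b ν) (hη.radMode hχ f m) from
      funext fun y ↦ (hf.dbarAlong_radMode hη hχ m (b ν) y).symm]

/-- **`L_Z` commutes with the mode multipliers.** [cite: Lange2023AbelianVarietiesComplex, §1.6.1 Prop. 1.6.3] -/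
theorem IsRadSection.radLaplace_radMul [FiniteDimensional ℂ E] {a : (Fin (subRank (nsRadical Φ η)) → ℤ) → ℂ}
    (ha : Summable fun m ↦ ‖a m‖) {f : E → ℂ} (hf : IsRadSection Φ η χ f) :
    radLaplace η b Z k (hη.radMul hχ a f) = hη.radMul hχ a (radLaplace η b Z k f) := by
  have hterm : ∀ ν ∈ Z, IsRadSection Φ η χ (fun z ↦ (((k ν)⁻¹ : ℝ) : ℂ) * deltaBar η (b ν) (dbarAlong (b ν) f) z) := by
    intro ν _
    have h := isRadSection_radLaplace hη (b := b) (Z := {ν}) (k := k) hf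
    have e : radLaplace η b {ν} k f = fun z ↦ (((k ν)⁻¹ : ℝ) : ℂ) * deltaBar η (b ν) (dbarAlong (b ν) f) z := by
      funext z; rw [radLaplace_apply, Finset.sum_singleton]
    rwa [e] at h
  rw [show radLaplace η b Z k f = fun z ↦ ∑ ν ∈ Z, (((k ν)⁻¹ : ℝ) : ℂ) * deltaBar η (b ν) (dbarAlong (b ν) f) z
    from funext fun z ↦ radLaplace_apply η b Z k f z, hη.radMul_finset_sum hχ ha Z hterm]
  funext x
  rw [radLaplace_apply η b Z k]
  refine Finset.sum_congr rfl fun ν _ ↦ ?_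
  rw [hη.radMul_const_mul hχ, ← (isRadSection_dbarAlong hf (b ν)).deltaBar_radMul hη hχ ha, ← hf.dbarAlong_radMul hη hχ ha]

/-! ### The symbol of `L_Z` on the modes -/

variable (k) in
/-- **The symbol `μ_m = π² Σ_{ν∈Z} k_ν⁻¹ |c_{e_ν}(θ + ρ_m)|²` of `L_Z` on the `m`-th mode** — row A2-82's
`greenSymb` of the torus `K(L)⁰` with the radical frame. [cite: Lange2023AbelianVarietiesComplex, §1.6.1 Prop. 1.6.3] -/
def IsNSForm.radSymb (hZ : ∀ ν ∈ Z, b ν ∈ radSpace Φ η) (m : Fin (subRank (nsRadical Φ η)) → ℤ) : ℝ :=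
  greenSymb hη.radPeriod (radFrame hZ) k (hη.radTwistParam hχ) m

/-- `θ + ρ_m = ρ_{m + t}` on `Φ(Λ(L)⁰)`. [cite: Lange2023AbelianVarietiesComplex, §1.4.1 Prop. 1.4.1] -/
theorem IsNSForm.radTwist_add_radFreq
    (m : Fin (subRank (nsRadical Φ η)) → ℤ) :
    hη.radTwist hχ + hη.radFreq m = coordFunctional hη.radPeriod (fun i ↦ (m i : ℝ) + hη.radTwistParam hχ i) := by
  rw [show (fun i ↦ (m i : ℝ) + hη.radTwistParam hχ i) = (fun i ↦ (m i : ℝ)) + hη.radTwistParam hχ from rfl,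
    coordFunctional_add, add_comm]
  rfl

/-- Unfolding of the symbol: `μ_m = π² Σ_{ν∈Z} k_ν⁻¹ |c_{e_ν}(θ + ρ_m)|²`. [cite: Lange2023AbelianVarietiesComplex, §1.6.1 Prop. 1.6.3] -/
theorem IsNSForm.radSymb_eq (hZ : ∀ ν ∈ Z, b ν ∈ radSpace Φ η) (m : Fin (subRank (nsRadical Φ η)) → ℤ) :
    hη.radSymb hχ k hZ m =
      π ^ 2 * ∑ ν ∈ Z, (k ν)⁻¹ * Complex.normSq (dbarSymb (hη.radTwist hχ + hη.radFreq m) (radFrame hZ ν)) := by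
  classical
  rw [IsNSForm.radSymb, greenSymb, laplaceSymb_apply, ← hη.radTwist_add_radFreq hχ]
  congr 1
  rw [← Finset.sum_filter_add_sum_filter_not Finset.univ (· ∈ Z)]
  have h1 : Finset.univ.filter (· ∈ Z) = Z := by ext ν; simp
  rw [h1, Finset.sum_eq_zero (s := Finset.univ.filter (· ∉ Z)) fun ν hν ↦ by
    rw [radFrame_of_not_mem hZ (Finset.mem_filter.1 hν).2, dbarSymb_apply]; simp, add_zero]

/-- `μ_m ≥ 0` for positive weights. [cite: Lange2023AbelianVarietiesComplex, §1.6.1 Prop. 1.6.3] -/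
theorem IsNSForm.radSymb_nonneg (hZ : ∀ ν ∈ Z, b ν ∈ radSpace Φ η) (hk : ∀ ν, 0 < k ν)
    (m : Fin (subRank (nsRadical Φ η)) → ℤ) : 0 ≤ hη.radSymb hχ k hZ m :=
  laplaceSymb_nonneg _ _ hk _

/-- **`L_Z` acts on the `m`-th mode by the scalar `μ_m`: `L_Z f^(m) = μ_m f^(m)`** (FILE 1: on the radical directions
`δ̄_w ∂̄_w f^(m) = π² |c_w(θ + ρ_m)|² f^(m)`). [cite: Lange2023AbelianVarietiesComplex, §1.6.1 Prop. 1.6.3] [cite: Grafakos2014, Prop. 3.1.2 (8)] -/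
theorem IsRadSection.radLaplace_radMode [FiniteDimensional ℂ E] (hZ : ∀ ν ∈ Z, b ν ∈ radSpace Φ η) {f : E → ℂ}
    (hf : IsRadSection Φ η χ f) (m : Fin (subRank (nsRadical Φ η)) → ℤ) (x : E) :
    radLaplace η b Z k (hη.radMode hχ f m) x = (hη.radSymb hχ k hZ m : ℂ) * hη.radMode hχ f m x := by
  rw [radLaplace_apply η b Z k, hη.radSymb_eq hχ hZ]
  push_cast
  rw [Finset.mul_sum, Finset.sum_mul]
  refine Finset.sum_congr rfl fun ν hν ↦ ?_
  rw [← coe_radFrame_of_mem hZ hν, hf.deltaBar_dbarAlong_coe_radMode hη hχ m x (radFrame hZ ν)]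
  push_cast
  ring

/-- **The modes of `L_Z f` are `μ_m f^(m)`.** [cite: Lange2023AbelianVarietiesComplex, §1.6.1 Prop. 1.6.3] -/
theorem IsRadSection.radMode_radLaplace_eq [FiniteDimensional ℂ E] (hZ : ∀ ν ∈ Z, b ν ∈ radSpace Φ η) {f : E → ℂ}
    (hf : IsRadSection Φ η χ f) (m : Fin (subRank (nsRadical Φ η)) → ℤ) (x : E) :
    hη.radMode hχ (radLaplace η b Z k f) m x = (hη.radSymb hχ k hZ m : ℂ) * hη.radMode hχ f m x := by
  rw [hf.radMode_radLaplace hη hχ, hf.radLaplace_radMode hη hχ hZ]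

/-- The modes of the iterates `L_Z^j f` are `μ_m^j f^(m)`. [cite: Lange2023AbelianVarietiesComplex, §1.6.1 Prop. 1.6.3] -/
theorem IsRadSection.radMode_radLaplace_iterate [FiniteDimensional ℂ E] (hZ : ∀ ν ∈ Z, b ν ∈ radSpace Φ η) {f : E → ℂ}
    (hf : IsRadSection Φ η χ f) (j : ℕ) (m : Fin (subRank (nsRadical Φ η)) → ℤ) (x : E) :
    hη.radMode hχ ((radLaplace η b Z k)^[j] f) m x = (hη.radSymb hχ k hZ m : ℂ) ^ j * hη.radMode hχ f m x := by
  induction j generalizing x with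
  | zero => simp
  | succ j ih =>
    have hj : IsRadSection Φ η χ ((radLaplace η b Z k)^[j] f) := by
      clear ih
      induction j with
      | zero => simpa using hf
      | succ j ih' => rw [Function.iterate_succ_apply']; exact isRadSection_radLaplace hη ih'
    rw [Function.iterate_succ_apply', hj.radMode_radLaplace_eq hη hχ hZ, ih, pow_succ]
    ring

omit [DecidableEq ι] in
include hη in
/-- The iterates `L_Z^j` preserve radical sections. [cite: Lange2023AbelianVarietiesComplex, §1.6.1 Prop. 1.6.3] -/
theorem isRadSection_radLaplace_iterate {f : E → ℂ} (hf : IsRadSection Φ η χ f) (j : ℕ) :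
    IsRadSection Φ η χ ((radLaplace η b Z k)^[j] f) := by
  induction j with
  | zero => simpa using hf
  | succ j ih => rw [Function.iterate_succ_apply']; exact isRadSection_radLaplace hη ih

omit [Fintype ι] [DecidableEq ι] in
include hη hχ in
/-- The iterates `L_Z^j` preserve `A^{0,0}(L)`. [cite: Lange2023AbelianVarietiesComplex, §1.6.1 Prop. 1.6.3] -/
theorem IsNSForm.radLaplace_iterate_mem_smoothTheta {f : E → ℂ}
    (hf : f ∈ smoothTheta Φ (canonicalFactor Φ η χ)) (j : ℕ) :
    (radLaplace η b Z k)^[j] f ∈ smoothTheta Φ (canonicalFactor Φ η χ) := by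
  induction j with
  | zero => simpa using hf
  | succ j ih => rw [Function.iterate_succ_apply']; exact hη.radLaplace_mem_smoothTheta hχ ih

include hη hχ in
/-- The iterates `L_Z^j` commute with `∂̄_u`. [cite: Lange2023AbelianVarietiesComplex, §1.6.1 Prop. 1.6.3] -/
theorem IsRadSection.dbarAlong_radLaplace_iterate [FiniteDimensional ℂ E] (hZ : ∀ ν ∈ Z, b ν ∈ radSpace Φ η)
    {f : E → ℂ} (hf : IsRadSection Φ η χ f) (j : ℕ) (u : E) :
    dbarAlong u ((radLaplace η b Z k)^[j] f) = (radLaplace η b Z k)^[j] (dbarAlong u f) := by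
  have h1 := isRadSection_dbarAlong (isRadSection_radLaplace_iterate hη (b := b) (Z := Z) (k := k) hf j) u
  have h2 := isRadSection_radLaplace_iterate hη (b := b) (Z := Z) (k := k) (isRadSection_dbarAlong hf u) j
  refine h1.eq_of_forall_radMode_eq hη hχ h2 fun m x ↦ ?_
  rw [← (isRadSection_radLaplace_iterate hη hf j).dbarAlong_radMode hη hχ, (isRadSection_dbarAlong hf u).radMode_radLaplace_iterate hη hχ hZ,
    ← hf.dbarAlong_radMode hη hχ]
  have hfun : hη.radMode hχ ((radLaplace η b Z k)^[j] f) m = fun y ↦ (hη.radSymb hχ k hZ m : ℂ) ^ j * hη.radMode hχ f m y :=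
    funext fun y ↦ hf.radMode_radLaplace_iterate hη hχ hZ j m y
  rw [hfun, Literature.Analysis.Pluripotential.dbarAlong_const_mul
    (((hf.contDiff_radMode hη hχ m).differentiable (by simp)) x)]

/-! ### The vacuum mode and the vacuum part -/

open Classical in
/-- **The vacuum mode(s)**: the `m ∈ ℤ^r` with `m + t = 0`, i.e. `θ + ρ_m = 0` — at most one, and one exists iff
`t ∈ ℤ^r` iff `χ_0 = 1` iff `L|_{K(L)⁰}` is trivial (`radVacSet_nonempty_iff`). [cite: Lange2023AbelianVarietiesComplex, §1.6.3 Thm. 1.6.8] -/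
def IsNSForm.radVacSet : Finset (Fin (subRank (nsRadical Φ η)) → ℤ) :=
  if h : ∃ m : Fin (subRank (nsRadical Φ η)) → ℤ, ∀ i, (m i : ℝ) + hη.radTwistParam hχ i = 0 then {h.choose} else ∅

/-- Membership in the vacuum set: `m + t = 0`. [cite: Lange2023AbelianVarietiesComplex, §1.6.3 Thm. 1.6.8] -/
theorem IsNSForm.mem_radVacSet_iff {m : Fin (subRank (nsRadical Φ η)) → ℤ} :
    m ∈ hη.radVacSet hχ ↔ ∀ i, (m i : ℝ) + hη.radTwistParam hχ i = 0 := by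
  rw [IsNSForm.radVacSet]
  split_ifs with h
  · rw [Finset.mem_singleton]
    constructor
    · rintro rfl; exact h.choose_spec
    · intro hm
      funext i
      have h1 := h.choose_spec i
      have h2 := hm i
      exact_mod_cast (by linarith : (m i : ℝ) = h.choose i)
  · simp only [Finset.notMem_empty, false_iff]
    exact fun hm ↦ h ⟨m, hm⟩

/-- At a vacuum mode `θ + ρ_m = 0`. [cite: Lange2023AbelianVarietiesComplex, §1.6.3 Thm. 1.6.8] -/
theorem IsNSForm.radTwist_add_radFreq_eq_zero {m : Fin (subRank (nsRadical Φ η)) → ℤ} (hm : m ∈ hη.radVacSet hχ) :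
    hη.radTwist hχ + hη.radFreq m = 0 := by
  classical
  rw [hη.radTwist_add_radFreq hχ, coordFunctional_eq_zero_iff]
  funext i
  exact (hη.mem_radVacSet_iff hχ).1 hm i

/-- **`μ_m = 0` iff `m` is a vacuum mode** (the radical frame spans `Φ(Λ(L)⁰)`, positive weights; coercivity of the
symbol, row A2-82). [cite: Lange2023AbelianVarietiesComplex, §1.6.3 Thm. 1.6.8] [cite: Lange2023AbelianVarietiesComplex, §1.6.1 Prop. 1.6.3] -/
theorem IsNSForm.radSymb_eq_zero_iff (hZ : ∀ ν ∈ Z, b ν ∈ radSpace Φ η)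
    (hspan : Submodule.span ℂ (Set.range (radFrame hZ)) = ⊤) (hk : ∀ ν, 0 < k ν) {m : Fin (subRank (nsRadical Φ η)) → ℤ} :
    hη.radSymb hχ k hZ m = 0 ↔ m ∈ hη.radVacSet hχ := by
  classical
  rw [IsNSForm.radSymb, greenSymb, laplaceSymb_eq_zero_iff _ hspan hk, hη.mem_radVacSet_iff hχ, funext_iff]
  rfl

/-- `μ_m > 0` off the vacuum set. [cite: Lange2023AbelianVarietiesComplex, §1.6.3 Thm. 1.6.8] -/
theorem IsNSForm.radSymb_pos (hZ : ∀ ν ∈ Z, b ν ∈ radSpace Φ η)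
    (hspan : Submodule.span ℂ (Set.range (radFrame hZ)) = ⊤) (hk : ∀ ν, 0 < k ν) {m : Fin (subRank (nsRadical Φ η)) → ℤ}
    (hm : m ∉ hη.radVacSet hχ) : 0 < hη.radSymb hχ k hZ m :=
  (hη.radSymb_nonneg hχ hZ hk m).lt_of_ne' fun h ↦ hm ((hη.radSymb_eq_zero_iff hχ hZ hspan hk).1 h)

/-- **The vacuum set is non-empty iff `χ_0 = χ|_{Λ_0} = 1`** ("`L|_{K(L)⁰}` is trivial"): `χ_0(n) = e(2πi⟨t, n⟩)` is
trivial iff `t ∈ ℤ^r`. [cite: Lange2023AbelianVarietiesComplex, §1.6.3 Thm. 1.6.8] [cite: Lange2023AbelianVarietiesComplex, §1.4.1 Prop. 1.4.1] -/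
theorem IsNSForm.radVacSet_nonempty_iff : (hη.radVacSet hχ).Nonempty ↔ radChar Φ η χ = 1 := by
  classical
  constructor
  · rintro ⟨m, hm⟩
    have ht : hη.radTwistParam hχ = fun i ↦ ((-m) i : ℝ) := by
      funext i
      have := (hη.mem_radVacSet_iff hχ).1 hm i
      simp only [Pi.neg_apply, Int.cast_neg]
      linarith
    funext n
    rw [hη.radChar_eq_twistExp hχ, Pi.one_apply, IsNSForm.radTwist, ht]
    exact twistExp_coordFunctional_intCast_latticeVec hη.radPeriod (-m) n
  · intro h1
    have hint : ∀ i, ∃ z : ℤ, hη.radTwistParam hχ i = z := by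
      intro i
      have h := hη.radChar_eq_twistExp hχ (Pi.single i 1)
      rw [h1, Pi.one_apply, IsNSForm.radTwist, twistExp_apply, coordFunctional_latticeVec] at h
      have hsum : (∑ j, hη.radTwistParam hχ j * ((Pi.single i (1 : ℤ) : Fin (subRank (nsRadical Φ η)) → ℤ) j : ℝ)) =
          hη.radTwistParam hχ i := by
        rw [Finset.sum_eq_single i (fun j _ hj ↦ by simp [Pi.single_eq_of_ne hj]) (by simp)]
        simp
      rw [hsum] at h
      obtain ⟨n, hn⟩ := Complex.exp_eq_one_iff.1 h.symm
      refine ⟨n, ?_⟩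
      have hI : (2 * π * I : ℂ) ≠ 0 := by simp [Real.pi_ne_zero, Complex.I_ne_zero]
      have : (hη.radTwistParam hχ i : ℂ) = n := by
        apply mul_left_cancel₀ hI
        rw [hn]
        ring
      exact_mod_cast this
    choose z hz using hint
    exact ⟨fun i ↦ -z i, (hη.mem_radVacSet_iff hχ).2 fun i ↦ by rw [hz i]; push_cast; ring⟩

/-- **The vacuum part `P₀ f = Σ_{m vacuum} f^(m)`** (`= f^(m₀)` if the vacuum mode `m₀` exists, `0` otherwise):
the `Λ(L)⁰`-invariant part of `f`. [cite: Lange2023AbelianVarietiesComplex, §1.6.3 Prop. 1.6.10 (Step 1)] -/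
def IsNSForm.radVac (f : E → ℂ) (x : E) : ℂ := ∑ m ∈ hη.radVacSet hχ, hη.radMode hχ f m x

/-- Unfolding of `radVac`. [cite: Lange2023AbelianVarietiesComplex, §1.6.3 Prop. 1.6.10 (Step 1)] -/
theorem IsNSForm.radVac_apply (f : E → ℂ) (x : E) :
    hη.radVac hχ f x = ∑ m ∈ hη.radVacSet hχ, hη.radMode hχ f m x := rfl

/-- Without a vacuum mode the vacuum part is `0`. [cite: Lange2023AbelianVarietiesComplex, §1.6.3 Thm. 1.6.8] -/
theorem IsNSForm.radVac_eq_zero_of_radChar_ne_one (h1 : radChar Φ η χ ≠ 1) (f : E → ℂ) : hη.radVac hχ f = 0 := by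
  funext x
  rw [hη.radVac_apply, Finset.not_nonempty_iff_eq_empty.1 (mt (hη.radVacSet_nonempty_iff hχ).1 h1),
    Finset.sum_empty, Pi.zero_apply]

variable [FiniteDimensional ℂ E]

/-- `P₀ f` is a radical section. [cite: Lange2023AbelianVarietiesComplex, §1.6.3 Prop. 1.6.10 (Step 1)] -/
theorem IsRadSection.radVac {f : E → ℂ} (hf : IsRadSection Φ η χ f) : IsRadSection Φ η χ (hη.radVac hχ f) :=
  IsRadSection.finset_sum _ fun m _ ↦ (hf.isPureMode_radMode hη hχ m).isRadSection

/-- `P₀` preserves `A^{0,0}(L)`. [cite: Lange2023AbelianVarietiesComplex, §1.6.3 Prop. 1.6.10 (Step 1)] -/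
theorem IsNSForm.radVac_mem_smoothTheta {f : E → ℂ}
    (hf : f ∈ smoothTheta Φ (canonicalFactor Φ η χ)) : hη.radVac hχ f ∈ smoothTheta Φ (canonicalFactor Φ η χ) := by
  have h : hη.radVac hχ f = ∑ m ∈ hη.radVacSet hχ, hη.radMode hχ f m := by
    funext x; simp [IsNSForm.radVac_apply, Finset.sum_apply]
  rw [h]
  exact Submodule.sum_mem _ fun m _ ↦ hη.radMode_mem_smoothTheta hχ hf m

/-- **The modes of the vacuum part**: `(P₀ f)^(m) = [m vacuum] f^(m)`. [cite: Grafakos2014, Prop. 3.2.7] -/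
theorem IsRadSection.radMode_radVac {f : E → ℂ} (hf : IsRadSection Φ η χ f) (m : Fin (subRank (nsRadical Φ η)) → ℤ)
    (x : E) : hη.radMode hχ (hη.radVac hχ f) m x = if m ∈ hη.radVacSet hχ then hη.radMode hχ f m x else 0 := by
  classical
  rw [show hη.radVac hχ f = fun z ↦ ∑ m' ∈ hη.radVacSet hχ, hη.radMode hχ f m' z from rfl,
    hη.radMode_finset_sum hχ _ (fun m' _ ↦ (hf.isPureMode_radMode hη hχ m').isRadSection)]
  simp_rw [hf.radMode_radMode hη hχ]
  rw [Finset.sum_ite_eq]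

omit [FiniteDimensional ℂ E] in
/-- **`P₀ f` is `Λ(L)⁰`-invariant: `P₀ f(x + w) = P₀ f(x)` for `w ∈ Φ(Λ(L)⁰)`** (the character of the vacuum mode is
trivial). [cite: Lange2023AbelianVarietiesComplex, §1.6.3 Prop. 1.6.10 (Step 1)] [cite: Lange2023AbelianVarietiesComplex, §1.5.4 Lemma 1.5.10] -/
theorem IsRadSection.radVac_add_coe {f : E → ℂ} (hf : IsRadSection Φ η χ f) (x : E) (w : radSpace Φ η) :
    hη.radVac hχ f (x + w) = hη.radVac hχ f x := by
  rw [hη.radVac_apply, hη.radVac_apply]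
  refine Finset.sum_congr rfl fun m hm ↦ ?_
  rw [hf.radMode_add_coe hη hχ]
  have h0 := hη.radTwist_add_radFreq_eq_zero hχ hm
  have h1 : twistExp (hη.radTwist hχ) w * twistExp (hη.radFreq m) w = 1 := by
    rw [twistExp_apply, twistExp_apply, ← Complex.exp_add]
    have : hη.radTwist hχ w + hη.radFreq m w = 0 := by
      have := congr_arg (fun ρ : radSpace Φ η →L[ℝ] ℝ ↦ ρ w) h0
      simpa using this
    rw [show 2 * (π : ℂ) * I * (hη.radTwist hχ w : ℂ) + 2 * π * I * (hη.radFreq m w : ℂ) =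
      2 * π * I * ((hη.radTwist hχ w + hη.radFreq m w : ℝ) : ℂ) by push_cast; ring, this]
    simp
  rw [h1, one_mul]

/-- **`∂̄_w P₀ f = 0` for `w ∈ Φ(Λ(L)⁰)`.** [cite: Lange2023AbelianVarietiesComplex, §1.6.3 Prop. 1.6.10 (Step 2)] -/
theorem IsRadSection.dbarAlong_coe_radVac {f : E → ℂ} (hf : IsRadSection Φ η χ f) (w : radSpace Φ η) (x : E) :
    dbarAlong (w : E) (hη.radVac hχ f) x = 0 := by
  rw [show hη.radVac hχ f = fun z ↦ ∑ m ∈ hη.radVacSet hχ, hη.radMode hχ f m z from rfl,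
    Literature.Analysis.Pluripotential.dbarAlong_finset_sum _ (fun m _ ↦
      ((hf.contDiff_radMode hη hχ m).differentiable (by simp)) x)]
  refine Finset.sum_eq_zero fun m hm ↦ ?_
  rw [hf.dbarAlong_coe_radMode hη hχ m x w, hη.radTwist_add_radFreq_eq_zero hχ hm, dbarSymb_apply]
  simp

/-- **`∂_w P₀ f = 0` for `w ∈ Φ(Λ(L)⁰)`.** [cite: Lange2023AbelianVarietiesComplex, §1.6.3 Prop. 1.6.10 (Step 2)] -/
theorem IsRadSection.delAlong_coe_radVac {f : E → ℂ} (hf : IsRadSection Φ η χ f) (w : radSpace Φ η) (x : E) :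
    delAlong (w : E) (hη.radVac hχ f) x = 0 := by
  rw [show hη.radVac hχ f = fun z ↦ ∑ m ∈ hη.radVacSet hχ, hη.radMode hχ f m z from rfl,
    delAlong_finset_sum _ (fun m _ ↦ ((hf.contDiff_radMode hη hχ m).differentiable (by simp)) x)]
  refine Finset.sum_eq_zero fun m hm ↦ ?_
  rw [hf.delAlong_coe_radMode hη hχ m x w, hη.radTwist_add_radFreq_eq_zero hχ hm, dbarSymb_apply]
  simp

/-- `P₀` commutes with `∂̄_u` for every `u ∈ V`. [cite: Grafakos2014, Prop. 3.1.2 (8)] -/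
theorem IsRadSection.dbarAlong_radVac {f : E → ℂ} (hf : IsRadSection Φ η χ f) (u : E) :
    dbarAlong u (hη.radVac hχ f) = hη.radVac hχ (dbarAlong u f) := by
  funext x
  rw [show hη.radVac hχ f = fun z ↦ ∑ m ∈ hη.radVacSet hχ, hη.radMode hχ f m z from rfl,
    Literature.Analysis.Pluripotential.dbarAlong_finset_sum _ (fun m _ ↦
      ((hf.contDiff_radMode hη hχ m).differentiable (by simp)) x), hη.radVac_apply]
  exact Finset.sum_congr rfl fun m _ ↦ hf.dbarAlong_radMode hη hχ m u x

/-- `P₀ P₀ = P₀`. [cite: Grafakos2014, Prop. 3.2.7] -/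
theorem IsRadSection.radVac_radVac {f : E → ℂ} (hf : IsRadSection Φ η χ f) :
    hη.radVac hχ (hη.radVac hχ f) = hη.radVac hχ f := by
  funext x
  rw [hη.radVac_apply, hη.radVac_apply]
  refine Finset.sum_congr rfl fun m hm ↦ ?_
  rw [hf.radMode_radVac hη hχ, if_pos hm]

/-- `P₀ T_a = Σ_{m vacuum} a_m f^(m)`; in particular `P₀ T_a f = 0` when `a` vanishes on the vacuum set.
[cite: Grafakos2014, Prop. 3.2.7] -/
theorem IsRadSection.radVac_radMul_eq_zero {a : (Fin (subRank (nsRadical Φ η)) → ℤ) → ℂ} (ha : Summable fun m ↦ ‖a m‖)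
    (ha0 : ∀ m ∈ hη.radVacSet hχ, a m = 0) {f : E → ℂ} (hf : IsRadSection Φ η χ f) :
    hη.radVac hχ (hη.radMul hχ a f) = 0 := by
  funext x
  rw [hη.radVac_apply, Pi.zero_apply]
  refine Finset.sum_eq_zero fun m hm ↦ ?_
  rw [hf.radMode_radMul hη hχ ha, ha0 m hm, zero_mul]

/-- `L_Z P₀ f = 0` (the vacuum part is killed by every `∂̄_{e_ν}`, `ν ∈ Z`).
[cite: Lange2023AbelianVarietiesComplex, §1.6.3 Prop. 1.6.10 (Step 2)] -/
theorem IsRadSection.radLaplace_radVac (hZ : ∀ ν ∈ Z, b ν ∈ radSpace Φ η) {f : E → ℂ} (hf : IsRadSection Φ η χ f) :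
    radLaplace η b Z k (hη.radVac hχ f) = 0 := by
  funext x
  rw [radLaplace_apply η b Z k, Pi.zero_apply]
  refine Finset.sum_eq_zero fun ν hν ↦ ?_
  have h0 : dbarAlong (b ν) (hη.radVac hχ f) = 0 := funext fun y ↦ by
    rw [← coe_radFrame_of_mem hZ hν, hf.dbarAlong_coe_radVac hη hχ]; rfl
  rw [h0, deltaBar_zero, mul_zero]

end Radical

/-! ## §4 The Green operator `G = L_Z^{N-1} T_a`, `a_m = [m ≠ m₀] μ_m^{-N}`, `N = rk Λ_0`: `L_Z G = 1 - P₀` -/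

section Green

variable {ι : Type*} [Fintype ι] [DecidableEq ι] {E : Type*} [NormedAddCommGroup E] [NormedSpace ℂ E]
  {Φ : (ι → ℝ) ≃L[ℝ] E} {η : E [⋀^Fin 2]→L[ℝ] ℝ} {χ : (ι → ℤ) → ℂ} {g : ℕ} {b : Fin g → E} {Z : Finset (Fin g)}
  (hη : IsNSForm Φ η) (hχ : IsSemicharacter Φ η χ) {k : Fin g → ℝ}

variable (k) in
/-- **The symbol `a_m = [m ≠ m₀] μ_m^{-N}` of `L_Z^{-N}` off the vacuum**, `N = r = rk Λ_0`.
[cite: Lange2023AbelianVarietiesComplex, §1.6.1 Thm. 1.6.1] [cite: HuybrechtsCG2005, §4.1 Thm. 4.1.13] -/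
def IsNSForm.radGreenCoeff (hZ : ∀ ν ∈ Z, b ν ∈ radSpace Φ η) (m : Fin (subRank (nsRadical Φ η)) → ℤ) : ℂ :=
  if m ∈ hη.radVacSet hχ then 0 else (((hη.radSymb hχ k hZ m)⁻¹ ^ subRank (nsRadical Φ η) : ℝ) : ℂ)

/-- `a_m = 0` on the vacuum set. [cite: HuybrechtsCG2005, §4.1 Thm. 4.1.13] -/
theorem IsNSForm.radGreenCoeff_of_mem (hZ : ∀ ν ∈ Z, b ν ∈ radSpace Φ η) {m : Fin (subRank (nsRadical Φ η)) → ℤ}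
    (hm : m ∈ hη.radVacSet hχ) : hη.radGreenCoeff hχ k hZ m = 0 := by
  rw [IsNSForm.radGreenCoeff, if_pos hm]

/-- `μ_m^N a_m = [m ≠ m₀]`. [cite: HuybrechtsCG2005, §4.1 Thm. 4.1.13] -/
theorem IsNSForm.radSymb_pow_mul_radGreenCoeff (hZ : ∀ ν ∈ Z, b ν ∈ radSpace Φ η)
    (hspan : Submodule.span ℂ (Set.range (radFrame hZ)) = ⊤) (hk : ∀ ν, 0 < k ν) (m : Fin (subRank (nsRadical Φ η)) → ℤ) :
    (hη.radSymb hχ k hZ m : ℂ) ^ subRank (nsRadical Φ η) * hη.radGreenCoeff hχ k hZ m =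
      if m ∈ hη.radVacSet hχ then 0 else 1 := by
  rw [IsNSForm.radGreenCoeff]
  split_ifs with hm
  · rw [mul_zero]
  · have hpos := hη.radSymb_pos hχ hZ hspan hk hm
    push_cast
    rw [← mul_pow, mul_inv_cancel₀ (by exact_mod_cast hpos.ne'), one_pow]

/-- **The Green symbol is summable**: `Σ_m |a_m| < ∞` — `μ_m ≥ c₀ ‖m + t‖²` (coercivity, row A2-82) gives
`μ_m^{-N} ≤ C (1 + |m|²)^{-N}` off a finite set, and `Σ_{m ∈ ℤ^N} (1 + |m|²)^{-N} < ∞`.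
[cite: Grafakos2014, Prop. 3.2.5] [cite: Lange2023AbelianVarietiesComplex, §1.6.1 Prop. 1.6.3] -/
theorem IsNSForm.summable_norm_radGreenCoeff (hZ : ∀ ν ∈ Z, b ν ∈ radSpace Φ η)
    (hspan : Submodule.span ℂ (Set.range (radFrame hZ)) = ⊤) (hk : ∀ ν, 0 < k ν) :
    Summable fun m ↦ ‖hη.radGreenCoeff hχ k hZ m‖ := by
  classical
  set r := subRank (nsRadical Φ η) with hr
  set t := hη.radTwistParam hχ with ht
  obtain ⟨c₀, hc₀, hle⟩ := exists_pos_mul_norm_sq_le_laplaceSymb hη.radPeriod (b := radFrame hZ) (k := k) hspan hk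
  -- the comparison series `C (1 + |m|²)^{-r}`
  set C : ℝ := (4 * (1 + (r : ℝ)) / c₀) ^ r with hC
  have hsum := (Torus.summable_inv_one_add_freqNormSq_pow_card (d := Fin r)).mul_left C
  simp only [Fintype.card_fin] at hsum
  refine Summable.of_norm_bounded_eventually hsum ?_
  -- off the finite set `{‖m‖ ≤ R}` the bound holds
  set R : ℝ := max 1 (2 * ‖t‖) with hR
  have hfin : {m : Fin r → ℤ | ‖(fun i ↦ (m i : ℝ))‖ ≤ R}.Finite := by
    have hsub : {m : Fin r → ℤ | ‖(fun i ↦ (m i : ℝ))‖ ≤ R} ⊆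
        (Fintype.piFinset fun _ : Fin r ↦ Finset.Icc (-⌈R⌉) ⌈R⌉ : Set (Fin r → ℤ)) := by
      intro m hm
      rw [Set.mem_setOf_eq, pi_norm_le_iff_of_nonneg (le_trans zero_le_one (le_max_left _ _))] at hm
      rw [Finset.mem_coe, Fintype.mem_piFinset]
      intro i
      have h := hm i
      rw [Real.norm_eq_abs, abs_le] at h
      rw [Finset.mem_Icc]
      constructor
      · have : ((-⌈R⌉ : ℤ) : ℝ) ≤ m i := by push_cast; linarith [Int.le_ceil R]
        exact_mod_cast this
      · have : (m i : ℝ) ≤ (⌈R⌉ : ℤ) := le_trans h.2 (Int.le_ceil R)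
        exact_mod_cast this
    exact (Finset.finite_toSet _).subset hsub
  refine (hfin.eventually_cofinite_notMem).mono fun m hm ↦ ?_
  rw [Set.mem_setOf_eq, not_le] at hm
  rw [norm_norm]
  -- `μ_m ≥ c₀ ‖m + t‖² ≥ c₀ ‖m‖²/4 ≥ c₀ (1 + |m|²)/(4(1+r))`
  have hm1 : 1 < ‖(fun i ↦ (m i : ℝ))‖ := lt_of_le_of_lt (le_max_left _ _) hm
  have hm2 : 2 * ‖t‖ < ‖(fun i ↦ (m i : ℝ))‖ := lt_of_le_of_lt (le_max_right _ _) hm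
  have hmt : ‖(fun i ↦ (m i : ℝ))‖ / 2 ≤ ‖(fun i ↦ (m i : ℝ) + t i)‖ := by
    have h : ‖(fun i ↦ (m i : ℝ))‖ ≤ ‖(fun i ↦ (m i : ℝ) + t i)‖ + ‖t‖ := by
      have h' := norm_sub_le (fun i ↦ (m i : ℝ) + t i) t
      have heq : (fun i ↦ (m i : ℝ) + t i) - t = fun i ↦ (m i : ℝ) := by funext i; simp
      rwa [heq] at h'
    linarith
  have hμ : c₀ * (‖(fun i ↦ (m i : ℝ))‖ / 2) ^ 2 ≤ hη.radSymb hχ k hZ m := by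
    have h := hle (fun i ↦ (m i : ℝ) + t i)
    rw [IsNSForm.radSymb, greenSymb]
    exact le_trans (mul_le_mul_of_nonneg_left (pow_le_pow_left₀ (by positivity) hmt 2) hc₀.le) h
  have hfreq : 1 + Torus.freqNormSq m ≤ (1 + r) * ‖(fun i ↦ (m i : ℝ))‖ ^ 2 := by
    have h1 : Torus.freqNormSq m ≤ r * ‖(fun i ↦ (m i : ℝ))‖ ^ 2 := by
      rw [Torus.freqNormSq]
      calc ∑ i, (m i : ℝ) ^ 2 ≤ ∑ _i : Fin r, ‖(fun i ↦ (m i : ℝ))‖ ^ 2 :=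
            Finset.sum_le_sum fun i _ ↦ by
              rw [← sq_abs, ← Real.norm_eq_abs]
              exact pow_le_pow_left₀ (norm_nonneg _) (norm_le_pi_norm (fun i ↦ (m i : ℝ)) i) 2
        _ = r * ‖(fun i ↦ (m i : ℝ))‖ ^ 2 := by simp
    nlinarith [hm1]
  have hμ' : c₀ / (4 * (1 + r)) * (1 + Torus.freqNormSq m) ≤ hη.radSymb hχ k hZ m := by
    calc c₀ / (4 * (1 + r)) * (1 + Torus.freqNormSq m) ≤ c₀ / (4 * (1 + r)) * ((1 + r) * ‖(fun i ↦ (m i : ℝ))‖ ^ 2) :=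
          mul_le_mul_of_nonneg_left hfreq (by positivity)
      _ = c₀ * (‖(fun i ↦ (m i : ℝ))‖ / 2) ^ 2 := by field_simp; ring
      _ ≤ _ := hμ
  have hfpos : 0 < 1 + Torus.freqNormSq m := by linarith [Torus.freqNormSq_nonneg m]
  have hμpos : 0 < hη.radSymb hχ k hZ m := lt_of_lt_of_le (by positivity) hμ'
  have hnot : m ∉ hη.radVacSet hχ := fun h ↦ hμpos.ne' ((hη.radSymb_eq_zero_iff hχ hZ hspan hk).2 h)
  rw [IsNSForm.radGreenCoeff, if_neg hnot, Complex.norm_real, Real.norm_eq_abs,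
    abs_of_nonneg (pow_nonneg (inv_nonneg.2 hμpos.le) _)]
  have h1 : (hη.radSymb hχ k hZ m)⁻¹ ≤ 4 * (1 + r) / c₀ * (1 + Torus.freqNormSq m)⁻¹ := by
    rw [show 4 * (1 + (r : ℝ)) / c₀ * (1 + Torus.freqNormSq m)⁻¹ = (c₀ / (4 * (1 + r)) * (1 + Torus.freqNormSq m))⁻¹ by
      field_simp]
    exact inv_anti₀ (by positivity) hμ'
  calc (hη.radSymb hχ k hZ m)⁻¹ ^ r ≤ (4 * (1 + r) / c₀ * (1 + Torus.freqNormSq m)⁻¹) ^ r :=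
        pow_le_pow_left₀ (inv_nonneg.2 hμpos.le) h1 r
    _ = C * ((1 + Torus.freqNormSq m) ^ r)⁻¹ := by rw [mul_pow, inv_pow]

variable (k) in
/-- **The Green operator `G = L_Z^{N-1} ∘ T_a` of the radical Laplacian** (`N = rk Λ_0`): on the modes
`(G f)^(m) = [m ≠ m₀] μ_m⁻¹ f^(m)` — the inverse of `L_Z` off the vacuum mode.
[cite: Lange2023AbelianVarietiesComplex, §1.6.1 Thm. 1.6.1] [cite: HuybrechtsCG2005, §4.1 Thm. 4.1.13] -/
def IsNSForm.radGreen (hZ : ∀ ν ∈ Z, b ν ∈ radSpace Φ η) (f : E → ℂ) : E → ℂ :=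
  (radLaplace η b Z k)^[subRank (nsRadical Φ η) - 1] (hη.radMul hχ (hη.radGreenCoeff hχ k hZ) f)

variable (hZ : ∀ ν ∈ Z, b ν ∈ radSpace Φ η) (hspan : Submodule.span ℂ (Set.range (radFrame hZ)) = ⊤)
  (hk : ∀ ν, 0 < k ν)

/-- Unfolding of `radGreen`. [cite: HuybrechtsCG2005, §4.1 Thm. 4.1.13] -/
theorem IsNSForm.radGreen_apply (f : E → ℂ) :
    hη.radGreen hχ k hZ f = (radLaplace η b Z k)^[subRank (nsRadical Φ η) - 1]
      (hη.radMul hχ (hη.radGreenCoeff hχ k hZ) f) := rfl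

variable [FiniteDimensional ℂ E]
include hspan hk

/-- `G f` is a radical section. [cite: HuybrechtsCG2005, §4.1 Thm. 4.1.13] -/
theorem IsRadSection.radGreen {f : E → ℂ} (hf : IsRadSection Φ η χ f) : IsRadSection Φ η χ (hη.radGreen hχ k hZ f) :=
  isRadSection_radLaplace_iterate hη (hf.radMul hη hχ (hη.summable_norm_radGreenCoeff hχ hZ hspan hk)) _

/-- **`G` maps `A^{0,0}(L)` to `A^{0,0}(L)`.** [cite: HuybrechtsCG2005, §4.1 Thm. 4.1.13] -/
theorem IsNSForm.radGreen_mem_smoothTheta {f : E → ℂ} (hf : f ∈ smoothTheta Φ (canonicalFactor Φ η χ)) :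
    hη.radGreen hχ k hZ f ∈ smoothTheta Φ (canonicalFactor Φ η χ) :=
  hη.radLaplace_iterate_mem_smoothTheta hχ (hη.radMul_mem_smoothTheta hχ (hη.summable_norm_radGreenCoeff hχ hZ hspan hk) hf) _

/-- **The modes of `G f`: `(G f)^(m) = [m ≠ m₀] μ_m⁻¹ f^(m)`.** [cite: HuybrechtsCG2005, §4.1 Thm. 4.1.13] [cite: Grafakos2014, Prop. 3.2.7] -/
theorem IsRadSection.radMode_radGreen {f : E → ℂ} (hf : IsRadSection Φ η χ f) (m : Fin (subRank (nsRadical Φ η)) → ℤ)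
    (x : E) : hη.radMode hχ (hη.radGreen hχ k hZ f) m x =
      (if m ∈ hη.radVacSet hχ then 0 else ((hη.radSymb hχ k hZ m)⁻¹ : ℂ)) * hη.radMode hχ f m x := by
  have ha := hη.summable_norm_radGreenCoeff hχ hZ hspan hk
  rw [hη.radGreen_apply, (hf.radMul hη hχ ha).radMode_radLaplace_iterate hη hχ hZ, hf.radMode_radMul hη hχ ha, ← mul_assoc]
  congr 1
  rw [IsNSForm.radGreenCoeff]
  split_ifs with hm
  · rw [mul_zero]
  · have hpos := hη.radSymb_pos hχ hZ hspan hk hm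
    have hne : (hη.radSymb hχ k hZ m : ℂ) ≠ 0 := by exact_mod_cast hpos.ne'
    -- `r ≥ 1`: for `r = 0` the only frequency is the vacuum
    have hr : 0 < subRank (nsRadical Φ η) := Nat.pos_of_ne_zero fun h0 ↦
      hm ((hη.mem_radVacSet_iff hχ).2 fun i ↦ by have := i.2; omega)
    have key : ∀ (u : ℂ) (n : ℕ), u ≠ 0 → 0 < n → u ^ (n - 1) * u⁻¹ ^ n = u⁻¹ := by
      intro u n hu hn
      obtain ⟨n', rfl⟩ := Nat.exists_eq_succ_of_ne_zero hn.ne'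
      rw [Nat.succ_sub_one, pow_succ, ← mul_assoc, ← mul_pow, mul_inv_cancel₀ hu, one_pow, one_mul]
    push_cast
    exact key _ _ hne hr

/-- **`L_Z G f = f - P₀ f`** (on the modes: `μ_m · [m ≠ m₀] μ_m⁻¹ = [m ≠ m₀]`).
[cite: Lange2023AbelianVarietiesComplex, §1.6.1 Thm. 1.6.1] [cite: HuybrechtsCG2005, §4.1 Thm. 4.1.13] -/
theorem IsRadSection.radLaplace_radGreen {f : E → ℂ} (hf : IsRadSection Φ η χ f) :
    radLaplace η b Z k (hη.radGreen hχ k hZ f) = f - hη.radVac hχ f := by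
  have hG := hf.radGreen hη hχ hZ hspan hk
  refine (isRadSection_radLaplace hη hG).eq_of_forall_radMode_eq hη hχ (hf.sub (hf.radVac hη hχ)) fun m x ↦ ?_
  rw [hG.radMode_radLaplace_eq hη hχ hZ, hf.radMode_radGreen hη hχ hZ hspan hk, sub_eq_add_neg, hf.radMode_add hη hχ (hf.radVac hη hχ).neg,
    show (-hη.radVac hχ f) = fun z ↦ (-1 : ℂ) * hη.radVac hχ f z by funext z; simp, hη.radMode_const_mul hχ,
    hf.radMode_radVac hη hχ]
  split_ifs with hm
  · simp
  · have hne : (hη.radSymb hχ k hZ m : ℂ) ≠ 0 := by exact_mod_cast (hη.radSymb_pos hχ hZ hspan hk hm).ne'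
    rw [← mul_assoc, mul_inv_cancel₀ hne]
    ring

/-- **`G ∂̄_u = ∂̄_u G`** for every `u ∈ V`. [cite: HuybrechtsCG2005, §4.1 Lemma 4.1.12] -/
theorem IsRadSection.dbarAlong_radGreen {f : E → ℂ} (hf : IsRadSection Φ η χ f) (u : E) :
    dbarAlong u (hη.radGreen hχ k hZ f) = hη.radGreen hχ k hZ (dbarAlong u f) := by
  have ha := hη.summable_norm_radGreenCoeff hχ hZ hspan hk
  rw [hη.radGreen_apply, (hf.radMul hη hχ ha).dbarAlong_radLaplace_iterate hη hχ hZ, hf.dbarAlong_radMul hη hχ ha, hη.radGreen_apply]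

/-- `P₀ G f = 0`. [cite: HuybrechtsCG2005, §4.1 Thm. 4.1.13] -/
theorem IsRadSection.radVac_radGreen {f : E → ℂ} (hf : IsRadSection Φ η χ f) : hη.radVac hχ (hη.radGreen hχ k hZ f) = 0 := by
  have hG := hf.radGreen hη hχ hZ hspan hk
  refine (hG.radVac hη hχ).eq_zero_of_forall_radMode_eq_zero hη hχ fun m x ↦ ?_
  rw [hG.radMode_radVac hη hχ, hf.radMode_radGreen hη hχ hZ hspan hk]
  split_ifs with hm <;> simp

/-- `G 0 = 0`. [cite: HuybrechtsCG2005, §4.1 Thm. 4.1.13] -/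
theorem IsNSForm.radGreen_zero : hη.radGreen hχ k hZ (0 : E → ℂ) = 0 := by
  refine ((IsRadSection.zero (Φ := Φ) (η := η) (χ := χ)).radGreen hη hχ hZ hspan hk).eq_zero_of_forall_radMode_eq_zero hη hχ fun m x ↦ ?_
  rw [(IsRadSection.zero (Φ := Φ) (η := η) (χ := χ)).radMode_radGreen hη hχ hZ hspan hk]
  have h := hη.radMode_const_mul hχ 0 (fun _ : E ↦ (0 : ℂ)) m x
  simp only [zero_mul] at h
  rw [show (0 : E → ℂ) = fun _ ↦ (0 : ℂ) from rfl, h, mul_zero]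

/-- `G` through finite sums of radical sections with constant coefficients. [cite: HuybrechtsCG2005, §4.1 Thm. 4.1.13] -/
theorem IsNSForm.radGreen_sum_smul {α : Type*} (s : Finset α) (c : α → ℂ) {F : α → E → ℂ}
    (hF : ∀ i ∈ s, IsRadSection Φ η χ (F i)) :
    hη.radGreen hχ k hZ (fun z ↦ ∑ i ∈ s, c i * F i z) = fun z ↦ ∑ i ∈ s, c i * hη.radGreen hχ k hZ (F i) z := by
  have h1 : IsRadSection Φ η χ (fun z ↦ ∑ i ∈ s, c i * F i z) :=
    IsRadSection.finset_sum s fun i hi ↦ (hF i hi).const_mul (c i)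
  have h2 : IsRadSection Φ η χ (fun z ↦ ∑ i ∈ s, c i * hη.radGreen hχ k hZ (F i) z) :=
    IsRadSection.finset_sum s fun i hi ↦ ((hF i hi).radGreen hη hχ hZ hspan hk).const_mul (c i)
  refine (h1.radGreen hη hχ hZ hspan hk).eq_of_forall_radMode_eq hη hχ h2 fun m x ↦ ?_
  rw [h1.radMode_radGreen hη hχ hZ hspan hk, hη.radMode_finset_sum hχ s (fun i hi ↦ (hF i hi).const_mul (c i)),
    hη.radMode_finset_sum hχ s (fun i hi ↦ ((hF i hi).radGreen hη hχ hZ hspan hk).const_mul (c i)), Finset.mul_sum]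
  refine Finset.sum_congr rfl fun i hi ↦ ?_
  rw [hη.radMode_const_mul hχ, hη.radMode_const_mul hχ, (hF i hi).radMode_radGreen hη hχ hZ hspan hk]
  ring

end Green

/-! ## §5 Proposition 1.6.3 for two frames; the homotopy formula `σ = ∂̄(δ̄_{e'} G σ)` for `∂̄`-closed
vacuum-free `σ`; `∂̄`-closed forms are `∂̄`-exact modulo their vacuum part -/

section TwoFrames

variable {E : Type*} [NormedAddCommGroup E] [NormedSpace ℂ E] {g : ℕ} (η : E [⋀^Fin 2]→L[ℝ] ℝ)
  (b b' : Fin g → E) (k : Fin g → ℝ)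

/-- **Proposition 1.6.3 (Lange 2023) for two frames `e` (in `∂̄`) and `e'` (in `δ̄`) with `H(e'_μ, e_ν) = 0` for all
`μ, ν`: `∂̄_e δ̄_{e'} + δ̄_{e'} ∂̄_e = Σ_ν k_ν⁻¹ δ̄_{e'_ν} ∂̄_{e_ν}` coefficientwise.** Proof as for the tree's
`laplaceForm_apply` (one frame): expand both compositions; the cross terms `(μ, ν)`, `μ ≠ ν`, cancel by
`[∂̄_{e_ν}, δ̄_{e'_μ}] = π H(e'_μ, e_ν) = 0` (`dbarAlong_deltaBar_sub_deltaBar_dbarAlong`) and the anticommutation sign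
`koszulSign_insert_mul_koszulSign_insert`; the diagonal terms commute as well (`H(e'_ν, e_ν) = 0`, no curvature term)
and add up over `ν ∈ I` and `ν ∉ I`. [cite: Lange2023AbelianVarietiesComplex, §1.6.1 Prop. 1.6.3] -/
theorem dbarForm_deltaForm_add_deltaForm_dbarForm (h11 : ∀ u v : E, η ![I • u, I • v] = η ![u, v])
    (hbb' : ∀ μ ν, hermOf η (b' μ) (b ν) = 0) {σ : Finset (Fin g) → E → ℂ}
    (hω : ∀ I, ContDiff ℝ ∞ (σ I)) (I : Finset (Fin g)) (x : E) :
    dbarForm b (deltaForm η b' k σ) I x + deltaForm η b' k (dbarForm b σ) I x =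
      ∑ ν, ((k ν)⁻¹ : ℝ) * deltaBar η (b' ν) (dbarAlong (b ν) (σ I)) x := by
  have h2 : (2 : WithTop ℕ∞) ≤ ∞ := WithTop.coe_le_coe.2 le_top
  -- smoothness bookkeeping
  have hdb : ∀ ν J, ContDiff ℝ ∞ (dbarAlong (b ν) (σ J)) := fun ν J ↦ contDiff_dbarAlong (hω J) (b ν)
  have hdl : ∀ ν J, ContDiff ℝ ∞ (deltaBar η (b' ν) (σ J)) := fun ν J ↦ contDiff_deltaBar h11 (hω J) (b' ν)
  have hdbd : ∀ ν J y, DifferentiableAt ℝ (dbarAlong (b ν) (σ J)) y :=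
    fun ν J y ↦ ((hdb ν J).differentiable (by simp)) y
  have hdld : ∀ ν J y, DifferentiableAt ℝ (deltaBar η (b' ν) (σ J)) y :=
    fun ν J y ↦ ((hdl ν J).differentiable (by simp)) y
  -- commutation of `δ̄'_μ` and `∂̄_ν` for ALL `μ, ν`
  have hcomm : ∀ μ ν J y,
      deltaBar η (b' μ) (dbarAlong (b ν) (σ J)) y = dbarAlong (b ν) (deltaBar η (b' μ) (σ J)) y := by
    intro μ ν J y
    have h := dbarAlong_deltaBar_sub_deltaBar_dbarAlong h11 (hω J) h2 (b' μ) (b ν) y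
    rw [hbb' μ ν, mul_zero, zero_mul, sub_eq_zero] at h
    exact h.symm
  -- Step 1: `(δ̄'∂̄σ)_I`
  have hA : deltaForm η b' k (dbarForm b σ) I x =
      ∑ μ ∈ Iᶜ, ((k μ)⁻¹ : ℝ) * deltaBar η (b' μ) (dbarAlong (b μ) (σ I)) x +
      ∑ μ ∈ Iᶜ, ∑ ν ∈ I, koszulSign μ I * ((k μ)⁻¹ : ℝ) * koszulSign ν (insert μ (I.erase ν)) *
        deltaBar η (b' μ) (dbarAlong (b ν) (σ (insert μ (I.erase ν)))) x := by
    rw [deltaForm_apply, ← Finset.sum_add_distrib]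
    refine Finset.sum_congr rfl fun μ hμ ↦ ?_
    have hμI : μ ∉ I := Finset.mem_compl.1 hμ
    have hfun : dbarForm b σ (insert μ I) = fun y ↦ ∑ ν ∈ insert μ I,
        koszulSign ν ((insert μ I).erase ν) * dbarAlong (b ν) (σ ((insert μ I).erase ν)) y := by
      funext y; rw [dbarForm_apply]
    rw [hfun, deltaBar_finset_sum _ (fun ν _ ↦ (hdbd ν _ x).const_mul _), Finset.sum_insert hμI,
      erase_insert hμI, deltaBar_const_mul (hdbd μ I x), mul_add, Finset.mul_sum]
    congr 1
    · have h1 := koszulSign_mul_self μ I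
      linear_combination (((k μ)⁻¹ : ℝ) : ℂ) * deltaBar η (b' μ) (dbarAlong (b μ) (σ I)) x * h1
    · refine Finset.sum_congr rfl fun ν hν ↦ ?_
      have hne : μ ≠ ν := fun h ↦ hμI (h ▸ hν)
      rw [erase_insert_of_ne hne, deltaBar_const_mul (hdbd ν _ x)]
      ring
  -- Step 2: `(∂̄δ̄'σ)_I`
  have hB : dbarForm b (deltaForm η b' k σ) I x =
      ∑ ν ∈ I, ((k ν)⁻¹ : ℝ) * dbarAlong (b ν) (deltaBar η (b' ν) (σ I)) x +
      ∑ ν ∈ I, ∑ μ ∈ Iᶜ, koszulSign ν (I.erase ν) * koszulSign μ (I.erase ν) * ((k μ)⁻¹ : ℝ) *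
        dbarAlong (b ν) (deltaBar η (b' μ) (σ (insert μ (I.erase ν)))) x := by
    rw [dbarForm_apply, ← Finset.sum_add_distrib]
    refine Finset.sum_congr rfl fun ν hν ↦ ?_
    have hνI : ν ∉ I.erase ν := Finset.notMem_erase ν I
    have hfun : deltaForm η b' k σ (I.erase ν) = fun y ↦ ∑ μ ∈ (I.erase ν)ᶜ,
        koszulSign μ (I.erase ν) * ((k μ)⁻¹ : ℝ) * deltaBar η (b' μ) (σ (insert μ (I.erase ν))) y := by
      funext y; rw [deltaForm_apply]
    rw [hfun, Literature.Analysis.Pluripotential.dbarAlong_finset_sum _ (fun μ _ ↦ (hdld μ _ x).const_mul _),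
      compl_erase, Finset.sum_insert (by simpa using hν), insert_erase hν,
      Literature.Analysis.Pluripotential.dbarAlong_const_mul (hdld ν I x), mul_add, Finset.mul_sum]
    congr 1
    · have h1 := koszulSign_mul_self ν (I.erase ν)
      linear_combination (((k ν)⁻¹ : ℝ) : ℂ) * dbarAlong (b ν) (deltaBar η (b' ν) (σ I)) x * h1
    · refine Finset.sum_congr rfl fun μ hμ ↦ ?_
      rw [Literature.Analysis.Pluripotential.dbarAlong_const_mul (hdld μ _ x)]
      ring
  -- Step 3: the cross terms cancel
  have hcross : ∑ μ ∈ Iᶜ, ∑ ν ∈ I, koszulSign μ I * ((k μ)⁻¹ : ℝ) * koszulSign ν (insert μ (I.erase ν)) *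
        deltaBar η (b' μ) (dbarAlong (b ν) (σ (insert μ (I.erase ν)))) x +
      ∑ ν ∈ I, ∑ μ ∈ Iᶜ, koszulSign ν (I.erase ν) * koszulSign μ (I.erase ν) * ((k μ)⁻¹ : ℝ) *
        dbarAlong (b ν) (deltaBar η (b' μ) (σ (insert μ (I.erase ν)))) x = 0 := by
    rw [Finset.sum_comm, ← Finset.sum_add_distrib]
    refine Finset.sum_eq_zero fun ν hν ↦ ?_
    rw [← Finset.sum_add_distrib]
    refine Finset.sum_eq_zero fun μ hμ ↦ ?_
    have hμI : μ ∉ I := Finset.mem_compl.1 hμ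
    have hne : μ ≠ ν := fun h ↦ hμI (h ▸ hν)
    have hμI' : μ ∉ I.erase ν := fun h ↦ hμI (Finset.mem_of_mem_erase h)
    have hνI' : ν ∉ I.erase ν := Finset.notMem_erase ν I
    have hI : insert ν (I.erase ν) = I := insert_erase hν
    have hsign := koszulSign_insert_mul_koszulSign_insert hμI' hνI' hne
    rw [hI] at hsign
    rw [hcomm μ ν _ x]
    linear_combination (((k μ)⁻¹ : ℝ) : ℂ) *
      dbarAlong (b ν) (deltaBar η (b' μ) (σ (insert μ (I.erase ν)))) x * hsign
  -- Step 4: assemble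
  rw [hA, hB]
  have hdiagsum : ∑ ν ∈ I, ((k ν)⁻¹ : ℝ) * dbarAlong (b ν) (deltaBar η (b' ν) (σ I)) x =
      ∑ ν ∈ I, ((k ν)⁻¹ : ℝ) * deltaBar η (b' ν) (dbarAlong (b ν) (σ I)) x :=
    Finset.sum_congr rfl fun ν _ ↦ by rw [hcomm]
  rw [hdiagsum, ← Finset.sum_compl_add_sum I (fun ν ↦ ((k ν)⁻¹ : ℝ) * deltaBar η (b' ν) (dbarAlong (b ν) (σ I)) x)]
  linear_combination hcross

end TwoFrames

section Homotopy

variable {ι : Type*} [Fintype ι] [DecidableEq ι] {E : Type*} [NormedAddCommGroup E] [NormedSpace ℂ E] [FiniteDimensional ℂ E]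
  {Φ : (ι → ℝ) ≃L[ℝ] E} {η : E [⋀^Fin 2]→L[ℝ] ℝ} {χ : (ι → ℤ) → ℂ} {g : ℕ} {b : Fin g → E} {Z : Finset (Fin g)}
  (hη : IsNSForm Φ η) (hχ : IsSemicharacter Φ η χ) {k : Fin g → ℝ}

/-- **`G` on `A^{0,•}(L)`, coefficientwise.** [cite: HuybrechtsCG2005, §4.1 Thm. 4.1.13] -/
def IsNSForm.radGreenForm (hZ : ∀ ν ∈ Z, b ν ∈ radSpace Φ η) (k : Fin g → ℝ) (σ : Finset (Fin g) → E → ℂ) :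
    Finset (Fin g) → E → ℂ :=
  fun I ↦ hη.radGreen hχ k hZ (σ I)

/-- **The vacuum part `P₀` on `A^{0,•}(L)`, coefficientwise.** [cite: Lange2023AbelianVarietiesComplex, §1.6.3 Prop. 1.6.10] -/
def IsNSForm.radVacForm (σ : Finset (Fin g) → E → ℂ) : Finset (Fin g) → E → ℂ := fun I ↦ hη.radVac hχ (σ I)

variable (hZ : ∀ ν ∈ Z, b ν ∈ radSpace Φ η) (hspan : Submodule.span ℂ (Set.range (radFrame hZ)) = ⊤)
  (hk : ∀ ν, 0 < k ν)

omit [FiniteDimensional ℂ E] in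
/-- Unfolding of `radGreenForm`. [cite: HuybrechtsCG2005, §4.1 Thm. 4.1.13] -/
theorem IsNSForm.radGreenForm_apply (σ : Finset (Fin g) → E → ℂ) (I : Finset (Fin g)) :
    hη.radGreenForm hχ hZ k σ I = hη.radGreen hχ k hZ (σ I) := rfl

omit [FiniteDimensional ℂ E] in
/-- Unfolding of `radVacForm`. [cite: Lange2023AbelianVarietiesComplex, §1.6.3 Prop. 1.6.10] -/
theorem IsNSForm.radVacForm_apply (σ : Finset (Fin g) → E → ℂ) (I : Finset (Fin g)) :
    hη.radVacForm hχ σ I = hη.radVac hχ (σ I) := rfl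

/-- `P₀` maps `A^{0,•}(L)` into itself. [cite: Lange2023AbelianVarietiesComplex, §1.6.3 Prop. 1.6.10] -/
theorem IsNSForm.radVacForm_mem_formSpace {σ : Finset (Fin g) → E → ℂ} (hσ : σ ∈ formSpace Φ (canonicalFactor Φ η χ) g) :
    hη.radVacForm hχ σ ∈ formSpace Φ (canonicalFactor Φ η χ) g :=
  mem_formSpace_iff.2 fun I ↦ hη.radVac_mem_smoothTheta hχ (mem_formSpace_iff.1 hσ I)

omit [FiniteDimensional ℂ E] in
/-- `P₀` preserves the degree. [cite: Lange2023AbelianVarietiesComplex, §1.6.3 Prop. 1.6.10] -/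
theorem IsHomogeneous.radVacForm {q : ℕ} {σ : Finset (Fin g) → E → ℂ} (hσ : IsHomogeneous q σ) :
    IsHomogeneous q (hη.radVacForm hχ σ) := fun I hI ↦ by
  rw [IsNSForm.radVacForm_apply, hσ I hI]
  funext x
  rw [hη.radVac_apply, Pi.zero_apply]
  refine Finset.sum_eq_zero fun m _ ↦ ?_
  have h := hη.radMode_const_mul hχ 0 (fun _ : E ↦ (0 : ℂ)) m x
  simp only [zero_mul] at h
  exact h

/-- **`∂̄ P₀ = P₀ ∂̄`.** [cite: Grafakos2014, Prop. 3.1.2 (8)] -/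
theorem IsNSForm.dbarForm_radVacForm {σ : Finset (Fin g) → E → ℂ} (hσ : σ ∈ formSpace Φ (canonicalFactor Φ η χ) g) :
    dbarForm b (hη.radVacForm hχ σ) = hη.radVacForm hχ (dbarForm b σ) := by
  have hσI : ∀ I, IsRadSection Φ η χ (σ I) := fun I ↦
    IsRadSection.of_mem_smoothTheta hη.type_one_one (mem_formSpace_iff.1 hσ I)
  funext J x
  have hfun : dbarForm b σ J = fun y ↦ ∑ ν ∈ J, koszulSign ν (J.erase ν) * dbarAlong (b ν) (σ (J.erase ν)) y := by
    funext y; rw [dbarForm_apply]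
  have hrhs : hη.radVac hχ (dbarForm b σ J) x =
      ∑ ν ∈ J, ∑ m ∈ hη.radVacSet hχ, koszulSign ν (J.erase ν) * hη.radMode hχ (dbarAlong (b ν) (σ (J.erase ν))) m x := by
    rw [hη.radVac_apply, hfun, Finset.sum_comm]
    refine Finset.sum_congr rfl fun m _ ↦ ?_
    rw [hη.radMode_finset_sum hχ _ (fun ν _ ↦ (isRadSection_dbarAlong (hσI _) _).const_mul _)]
    exact Finset.sum_congr rfl fun ν _ ↦ hη.radMode_const_mul hχ _ _ m x
  rw [IsNSForm.radVacForm_apply, hrhs, dbarForm_apply]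
  refine Finset.sum_congr rfl fun ν _ ↦ ?_
  rw [IsNSForm.radVacForm_apply, (hσI _).dbarAlong_radVac hη hχ, hη.radVac_apply, Finset.mul_sum]

/-- `P₀ P₀ = P₀` on forms. [cite: Grafakos2014, Prop. 3.2.7] -/
theorem IsNSForm.radVacForm_radVacForm {σ : Finset (Fin g) → E → ℂ} (hσ : σ ∈ formSpace Φ (canonicalFactor Φ η χ) g) :
    hη.radVacForm hχ (hη.radVacForm hχ σ) = hη.radVacForm hχ σ := by
  funext I
  exact (IsRadSection.of_mem_smoothTheta hη.type_one_one (mem_formSpace_iff.1 hσ I)).radVac_radVac hη hχ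

/-- `P₀ (σ - P₀ σ) = 0`. [cite: Grafakos2014, Prop. 3.2.7] -/
theorem IsNSForm.radVac_sub_radVacForm {σ : Finset (Fin g) → E → ℂ} (hσ : σ ∈ formSpace Φ (canonicalFactor Φ η χ) g)
    (I : Finset (Fin g)) : hη.radVac hχ ((σ - hη.radVacForm hχ σ) I) = 0 := by
  have hσI : IsRadSection Φ η χ (σ I) := IsRadSection.of_mem_smoothTheta hη.type_one_one (mem_formSpace_iff.1 hσ I)
  funext x
  rw [Pi.sub_apply, IsNSForm.radVacForm_apply, hη.radVac_apply, Pi.zero_apply]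
  refine Finset.sum_eq_zero fun m hm ↦ ?_
  rw [sub_eq_add_neg, hσI.radMode_add hη hχ (hσI.radVac hη hχ).neg,
    show (-hη.radVac hχ (σ I)) = fun z ↦ (-1 : ℂ) * hη.radVac hχ (σ I) z by funext z; simp,
    hη.radMode_const_mul hχ, hσI.radMode_radVac hη hχ, if_pos hm]
  ring

include hη hχ hspan hk

/-- `G` maps `A^{0,•}(L)` into itself. [cite: HuybrechtsCG2005, §4.1 Thm. 4.1.13] -/
theorem IsNSForm.radGreenForm_mem_formSpace {σ : Finset (Fin g) → E → ℂ} (hσ : σ ∈ formSpace Φ (canonicalFactor Φ η χ) g) :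
    hη.radGreenForm hχ hZ k σ ∈ formSpace Φ (canonicalFactor Φ η χ) g :=
  mem_formSpace_iff.2 fun I ↦ hη.radGreen_mem_smoothTheta hχ hZ hspan hk (mem_formSpace_iff.1 hσ I)

/-- `G` preserves the degree. [cite: HuybrechtsCG2005, §4.1 Thm. 4.1.13] -/
theorem IsHomogeneous.radGreenForm {q : ℕ} {σ : Finset (Fin g) → E → ℂ} (hσ : IsHomogeneous q σ) :
    IsHomogeneous q (hη.radGreenForm hχ hZ k σ) := fun I hI ↦ by
  rw [IsNSForm.radGreenForm_apply, hσ I hI, hη.radGreen_zero hχ hZ hspan hk]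

/-- **`∂̄ G = G ∂̄` on `A^{0,•}(L)`.** [cite: HuybrechtsCG2005, §4.1 Lemma 4.1.12] -/
theorem IsNSForm.dbarForm_radGreenForm {σ : Finset (Fin g) → E → ℂ} (hσ : σ ∈ formSpace Φ (canonicalFactor Φ η χ) g) :
    dbarForm b (hη.radGreenForm hχ hZ k σ) = hη.radGreenForm hχ hZ k (dbarForm b σ) := by
  have hσI : ∀ I, IsRadSection Φ η χ (σ I) := fun I ↦
    IsRadSection.of_mem_smoothTheta hη.type_one_one (mem_formSpace_iff.1 hσ I)
  funext J
  have hfun : dbarForm b σ J = fun y ↦ ∑ ν ∈ J, koszulSign ν (J.erase ν) * dbarAlong (b ν) (σ (J.erase ν)) y := by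
    funext y; rw [dbarForm_apply]
  rw [IsNSForm.radGreenForm_apply, hfun, hη.radGreen_sum_smul hχ hZ hspan hk _ _ (fun ν _ ↦ isRadSection_dbarAlong (hσI _) _)]
  funext x
  rw [dbarForm_apply]
  refine Finset.sum_congr rfl fun ν _ ↦ ?_
  rw [IsNSForm.radGreenForm_apply, (hσI _).dbarAlong_radGreen hη hχ hZ hspan hk]

/-- **THE HOMOTOPY FORMULA**: for `σ ∈ A^{0,•}(L)` with `∂̄σ = 0` and vanishing vacuum part,
`σ = ∂̄(δ̄_{e'} G σ)` with the radical frame `e'` in `δ̄` (`∂̄_e δ̄_{e'} τ + δ̄_{e'} ∂̄_e τ = L_Z τ` for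
`τ = Gσ`, `∂̄τ = G ∂̄σ = 0`, `L_Z G σ = σ - P₀ σ = σ`). [cite: Lange2023AbelianVarietiesComplex, §1.6.1 Thm. 1.6.1] [cite: HuybrechtsCG2005, §4.1 Thm. 4.1.13] -/
theorem IsNSForm.dbarForm_deltaForm_radGreenForm {σ : Finset (Fin g) → E → ℂ}
    (hσ : σ ∈ formSpace Φ (canonicalFactor Φ η χ) g) (hclosed : dbarForm b σ = 0)
    (hvac : ∀ I, hη.radVac hχ (σ I) = 0) :
    dbarForm b (deltaForm η (fun ν ↦ (radFrame hZ ν : E)) k (hη.radGreenForm hχ hZ k σ)) = σ := by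
  have hσI : ∀ I, IsRadSection Φ η χ (σ I) := fun I ↦
    IsRadSection.of_mem_smoothTheta hη.type_one_one (mem_formSpace_iff.1 hσ I)
  set τ := hη.radGreenForm hχ hZ k σ with hτ
  have hτs : ∀ I, ContDiff ℝ ∞ (τ I) := fun I ↦
    (mem_formSpace_iff.1 (hη.radGreenForm_mem_formSpace hχ hZ hspan hk hσ) I).1
  have hdτ : dbarForm b τ = 0 := by
    rw [hτ, hη.dbarForm_radGreenForm hχ hZ hspan hk hσ, hclosed]
    funext I
    rw [IsNSForm.radGreenForm_apply, Pi.zero_apply, hη.radGreen_zero hχ hZ hspan hk]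
  have hbb' : ∀ μ ν, hermOf η (radFrame hZ μ : E) (b ν) = 0 := fun μ ν ↦ hη.hermOf_coe_radSpace _ _
  funext I x
  have h := dbarForm_deltaForm_add_deltaForm_dbarForm η b (fun ν ↦ (radFrame hZ ν : E)) k hη.type_one_one hbb' hτs I x
  rw [hdτ, deltaForm_zero, Pi.zero_apply, Pi.zero_apply, add_zero, ← radLaplace_eq_sum_radFrame η k hZ] at h
  rw [h, hτ, IsNSForm.radGreenForm_apply, (hσI I).radLaplace_radGreen hη hχ hZ hspan hk, hvac I, sub_zero]

/-- **A `∂̄`-closed form with vanishing vacuum part is `∂̄`-exact** (`q ≥ 1`), with the explicit primitive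
`δ̄_{e'} G σ ∈ A^{0,q-1}(L)`. [cite: Lange2023AbelianVarietiesComplex, §1.6.1 Thm. 1.6.1] [cite: HuybrechtsCG2005, §4.1 Thm. 4.1.13] -/
theorem IsNSForm.mem_dbarExactForms_of_radVac_eq_zero {q : ℕ} (hq : 1 ≤ q) {σ : Finset (Fin g) → E → ℂ}
    (hσ : σ ∈ dbarClosedForms Φ η χ b q) (hvac : ∀ I, hη.radVac hχ (σ I) = 0) :
    σ ∈ dbarExactForms Φ η χ b q := by
  obtain ⟨hσA, hσq, hσd⟩ := hσ
  obtain ⟨q', rfl⟩ : ∃ q', q = q' + 1 := ⟨q - 1, by omega⟩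
  refine ⟨hσq, deltaForm η (fun ν ↦ (radFrame hZ ν : E)) k (hη.radGreenForm hχ hZ k σ),
    deltaForm_mem_formSpace _ η k hη (hη.radGreenForm_mem_formSpace hχ hZ hspan hk hσA), ?_,
    hη.dbarForm_deltaForm_radGreenForm hχ hZ hspan hk hσA hσd hvac⟩
  simpa using IsHomogeneous.deltaForm (fun ν ↦ (radFrame hZ ν : E)) η k (hσq.radGreenForm hη hχ hZ hspan hk)

/-- **In degree `0`: a `∂̄`-closed section with vanishing vacuum part is `0`** (the primitive is a `(0,-1)`-form).
[cite: Lange2023AbelianVarietiesComplex, §1.6.3 Thm. 1.6.8] -/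
theorem IsNSForm.eq_zero_of_radVac_eq_zero {σ : Finset (Fin g) → E → ℂ} (hσ : σ ∈ dbarClosedForms Φ η χ b 0)
    (hvac : ∀ I, hη.radVac hχ (σ I) = 0) : σ = 0 := by
  obtain ⟨hσA, hσq, hσd⟩ := hσ
  rw [← hη.dbarForm_deltaForm_radGreenForm hχ hZ hspan hk hσA hσd hvac,
    IsHomogeneous.deltaForm_eq_zero_of_zero (hσq.radGreenForm hη hχ hZ hspan hk), dbarForm_zero]

/-- **Every `∂̄`-closed form is `∂̄`-cohomologous to its vacuum part**: `σ - P₀σ ∈ B^{0,q}_∂̄(X, L)` for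
`σ ∈ Z^{0,q}_∂̄(X, L)`, every `q ≥ 0`. [cite: Lange2023AbelianVarietiesComplex, §1.6.1 Thm. 1.6.1] [cite: Lange2023AbelianVarietiesComplex, §1.6.4 Exercise (2)] -/
theorem IsNSForm.sub_radVacForm_mem_dbarExactForms {q : ℕ} {σ : Finset (Fin g) → E → ℂ}
    (hσ : σ ∈ dbarClosedForms Φ η χ b q) : σ - hη.radVacForm hχ σ ∈ dbarExactForms Φ η χ b q := by
  have hσA := hσ.1
  have hPσ : hη.radVacForm hχ σ ∈ dbarClosedForms Φ η χ b q := by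
    refine ⟨hη.radVacForm_mem_formSpace hχ hσA, (hσ.2.1).radVacForm hη hχ, ?_⟩
    rw [hη.dbarForm_radVacForm hχ hσA, hσ.2.2]
    funext I x
    rw [IsNSForm.radVacForm_apply, Pi.zero_apply, hη.radVac_apply, Pi.zero_apply]
    refine Finset.sum_eq_zero fun m _ ↦ ?_
    have h := hη.radMode_const_mul hχ 0 (fun _ : E ↦ (0 : ℂ)) m x
    simp only [zero_mul] at h
    exact h
  have hdiff : σ - hη.radVacForm hχ σ ∈ dbarClosedForms Φ η χ b q := sub_mem hσ hPσ
  rcases Nat.eq_zero_or_pos q with rfl | hq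
  · rw [hη.eq_zero_of_radVac_eq_zero hχ hZ hspan hk hdiff (hη.radVac_sub_radVacForm hχ hσA)]
    exact zero_mem _
  · exact hη.mem_dbarExactForms_of_radVac_eq_zero hχ hZ hspan hk hq hdiff (hη.radVac_sub_radVacForm hχ hσA)

/-- The same as an identity of Dolbeault classes: `[σ] = [P₀σ]` in `H^{0,q}_∂̄(X, L)`.
[cite: Lange2023AbelianVarietiesComplex, §1.6.4 Exercise (2)] -/
theorem IsNSForm.radVacForm_mem_dbarClosedForms {q : ℕ} {σ : Finset (Fin g) → E → ℂ}
    (hσ : σ ∈ dbarClosedForms Φ η χ b q) : hη.radVacForm hχ σ ∈ dbarClosedForms Φ η χ b q := by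
  have h := sub_mem hσ ((dbarExactForms_le_dbarClosedForms b q hη hχ) (hη.sub_radVacForm_mem_dbarExactForms hχ hZ hspan hk hσ))
  simpa using h

/-! ### `L|_{K(L)⁰}` non-trivial: all `∂̄`-closed forms are exact -/

/-- **`Z^{0,q}_∂̄(X, L) ⊆ B^{0,q}_∂̄(X, L)` for every `q` when `χ|_{Λ ∩ Λ(L)⁰} ≠ 1`** (no vacuum mode: `P₀ = 0`).
[cite: Lange2023AbelianVarietiesComplex, §1.6.3 Thm. 1.6.8] -/
theorem IsNSForm.dbarClosedForms_le_dbarExactForms_of_radChar_ne_one (h1 : radChar Φ η χ ≠ 1) (q : ℕ) :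
    dbarClosedForms Φ η χ b q ≤ dbarExactForms Φ η χ b q := fun σ hσ ↦ by
  have h := hη.sub_radVacForm_mem_dbarExactForms hχ hZ hspan hk hσ
  rwa [show hη.radVacForm hχ σ = 0 from funext fun I ↦ hη.radVac_eq_zero_of_radChar_ne_one hχ h1 (σ I), sub_zero] at h

/-- **`H^{0,q}_∂̄(X, L) = 0` for all `q` when `L|_{K(L)⁰}` is non-trivial** (Thm. 1.6.8, "`0` otherwise", with Thm. 1.6.1
for these bundles). [cite: Lange2023AbelianVarietiesComplex, §1.6.3 Thm. 1.6.8] [cite: Lange2023AbelianVarietiesComplex, §1.6.1 Thm. 1.6.1] -/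
theorem IsNSForm.subsingleton_dbarCohomology_of_radChar_ne_one (h1 : radChar Φ η χ ≠ 1) (q : ℕ) :
    Subsingleton (dbarCohomology Φ η χ b q) := by
  have hle := hη.dbarClosedForms_le_dbarExactForms_of_radChar_ne_one hχ hZ hspan hk h1 q
  refine ⟨fun x y ↦ ?_⟩
  induction x using Submodule.Quotient.induction_on with
  | H σ =>
    induction y using Submodule.Quotient.induction_on with
    | H τ =>
      rw [← dbarCohomology.mk, ← dbarCohomology.mk, dbarCohomology.mk_eq_mk_iff]
      exact sub_mem (hle σ.2) (hle τ.2)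

/-- **`dim_ℂ H^{0,q}_∂̄(X, L) = 0`** when `L|_{K(L)⁰}` is non-trivial. [cite: Lange2023AbelianVarietiesComplex, §1.6.3 Thm. 1.6.8] -/
theorem IsNSForm.finrank_dbarCohomology_of_radChar_ne_one (h1 : radChar Φ η χ ≠ 1) (q : ℕ) :
    Module.finrank ℂ (dbarCohomology Φ η χ b q) = 0 := by
  haveI := hη.subsingleton_dbarCohomology_of_radChar_ne_one hχ hZ hspan hk h1 q
  exact Module.finrank_zero_of_subsingleton

/-- **`ℋ^q(L) = 0` when `L|_{K(L)⁰}` is non-trivial**, for an `H`-orthogonal frame containing a radical sub-frame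
(through the injection `ℋ^q ↪ H^{0,q}_∂̄` of row A2-79; Lange's Cor. 1.6.5 / Thm. 1.6.8 at the harmonic level).
[cite: Lange2023AbelianVarietiesComplex, §1.6.3 Thm. 1.6.8] [cite: HuybrechtsCG2005, §4.1 Cor. 4.1.14] -/
theorem IsNSForm.harmonicForms_eq_bot_of_radChar_ne_one (hb : ∀ μ ν, μ ≠ ν → hermOf η (b μ) (b ν) = 0)
    (h1 : radChar Φ η χ ≠ 1) (q : ℕ) : hη.harmonicForms b k χ q = (⊥ : Submodule ℂ _) := by
  haveI := hη.subsingleton_dbarCohomology_of_radChar_ne_one hχ hZ hspan hk h1 q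
  have hinj := hη.harmonicToDolbeault_injective (q := q) hχ hb hk
  refine (Submodule.eq_bot_iff _).2 fun σ hσ ↦ ?_
  have h : (⟨σ, hσ⟩ : ↥(hη.harmonicForms b k χ q)) = 0 := hinj (Subsingleton.elim _ _)
  exact congrArg Subtype.val h

/-- **Theorem 1.6.1 (Lange 2023) when `L|_{K(L)⁰}` is non-trivial: `ℋ^q(L) → H^{0,q}_∂̄(X, L)` is bijective in every
degree** (both sides vanish). [cite: Lange2023AbelianVarietiesComplex, §1.6.1 Thm. 1.6.1] [cite: HuybrechtsCG2005, §4.1 Cor. 4.1.14] -/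
theorem IsNSForm.harmonicToDolbeault_bijective_of_radChar_ne_one (hb : ∀ μ ν, μ ≠ ν → hermOf η (b μ) (b ν) = 0)
    (h1 : radChar Φ η χ ≠ 1) (q : ℕ) : Function.Bijective (hη.harmonicToDolbeault (q := q) hχ hb hk) := by
  haveI := hη.subsingleton_dbarCohomology_of_radChar_ne_one hχ hZ hspan hk h1 q
  exact ⟨hη.harmonicToDolbeault_injective (q := q) hχ hb hk, fun c ↦ ⟨0, Subsingleton.elim _ _⟩⟩

end Homotopy

/-! ## §6 `H`-orthogonal bases: the zero directions span the radical; the theorems for the frames of rows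
A2-77 / A2-79 / A2-93, and the criterion "`L|_{K(L)⁰}` trivial" in Lange's form -/

section DiagZero

variable {ι : Type*} [Fintype ι] [DecidableEq ι] {E : Type*} [NormedAddCommGroup E] [NormedSpace ℂ E]
  {Φ : (ι → ℝ) ≃L[ℝ] E} {η : E [⋀^Fin 2]→L[ℝ] ℝ} {χ : (ι → ℤ) → ℂ} {g : ℕ} {w : Module.Basis (Fin g) ℂ E}
  {c : Fin g → ℝ}

variable (c) in
/-- The zero directions `Z = {ν | c_ν = 0}` of a diagonal `c_ν = H(e_ν, e_ν)` (Lange's `{r+s+1, …, g}`).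
[cite: Lange2023AbelianVarietiesComplex, §1.6.3 (1.29)] -/
def diagZero : Finset (Fin g) := Finset.univ.filter fun ν ↦ c ν = 0

/-- Membership in `diagZero`. [cite: Lange2023AbelianVarietiesComplex, §1.6.3 (1.29)] -/
theorem mem_diagZero {ν : Fin g} : ν ∈ diagZero c ↔ c ν = 0 := by simp [diagZero]

/-- For an `H`-orthogonal basis, `H(e_ν, u) = a_ν c_ν` where `u = Σ a_μ e_μ` — precisely,
`H(u, e_ν) = (repr u ν) c_ν`. [cite: Lange2023AbelianVarietiesComplex, §1.6.1 p0063] -/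
theorem hermOf_basis_right_eq (horth : ∀ μ ν, hermOf η (w μ) (w ν) = if μ = ν then (c μ : ℂ) else 0) (u : E)
    (ν : Fin g) : hermOf η u (w ν) = w.repr u ν * c ν := by
  conv_lhs => rw [← w.sum_repr u]
  rw [show hermOf η (∑ i, w.repr u i • w i) (w ν) = hermOfCLM η (w ν) (∑ i, w.repr u i • w i) from rfl, map_sum]
  simp_rw [map_smul, hermOfCLM_apply, horth, smul_eq_mul]
  rw [Finset.sum_eq_single ν (fun μ _ hμ ↦ by rw [if_neg hμ, mul_zero]) (by simp), if_pos rfl]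

omit [Fintype ι] [DecidableEq ι] in
/-- **The zero directions of an `H`-orthogonal basis lie in the radical**: `c_ν = 0 ⟹ e_ν ∈ Φ(Λ(L)⁰)`.
[cite: Lange2023AbelianVarietiesComplex, §1.6.3 (1.29)] [cite: Lange2023AbelianVarietiesComplex, §1.5.4 (1.22)] -/
theorem IsNSForm.basis_mem_radSpace_of_diag_eq_zero (hη : IsNSForm Φ η)
    (horth : ∀ μ ν, hermOf η (w μ) (w ν) = if μ = ν then (c μ : ℂ) else 0) {ν : Fin g} (hν : c ν = 0) :
    w ν ∈ radSpace Φ η := by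
  have h11 := hη.type_one_one
  have hzero : ∀ u : E, hermOf η (w ν) u = 0 := fun u ↦ by
    rw [hermOf_swap η h11, hermOf_basis_right_eq horth, hν]
    simp
  rw [radSpace, mem_cxSpan_iff (isComplexSubspace_nsRadical Φ h11), mem_nsRadical_iff_hermOf Φ h11]
  intro u
  rw [ContinuousLinearEquiv.apply_symm_apply]
  exact hzero u

omit [Fintype ι] [DecidableEq ι] in
/-- The radical-membership hypothesis `hZ` for the zero directions of an `H`-orthogonal basis.
[cite: Lange2023AbelianVarietiesComplex, §1.6.3 (1.29)] -/
theorem IsNSForm.diagZero_mem_radSpace (hη : IsNSForm Φ η)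
    (horth : ∀ μ ν, hermOf η (w μ) (w ν) = if μ = ν then (c μ : ℂ) else 0) :
    ∀ ν ∈ diagZero c, w ν ∈ radSpace Φ η := fun _ hν ↦
  hη.basis_mem_radSpace_of_diag_eq_zero horth (mem_diagZero.1 hν)

omit [Fintype ι] [DecidableEq ι] in
/-- **The zero directions of an `H`-orthogonal basis SPAN the radical** (`Λ(L)⁰ = ⟨e_ν | c_ν = 0⟩_ℂ`, Lange (1.29)):
for `u ∈ Φ(Λ(L)⁰)`, `0 = H(u, e_μ) = (repr u μ) c_μ` kills every coordinate with `c_μ ≠ 0`.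
[cite: Lange2023AbelianVarietiesComplex, §1.6.3 (1.29)] -/
theorem IsNSForm.span_radFrame_diagZero_eq_top (hη : IsNSForm Φ η)
    (horth : ∀ μ ν, hermOf η (w μ) (w ν) = if μ = ν then (c μ : ℂ) else 0) :
    Submodule.span ℂ (Set.range (radFrame (hη.diagZero_mem_radSpace horth))) = ⊤ := by
  classical
  set hZ := hη.diagZero_mem_radSpace horth with hZdef
  refine Submodule.eq_top_iff'.2 fun u ↦ ?_
  -- coordinates off `Z` vanish
  have hcoord : ∀ μ, μ ∉ diagZero c → w.repr (u : E) μ = 0 := by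
    intro μ hμ
    have hc : c μ ≠ 0 := fun h ↦ hμ (mem_diagZero.2 h)
    have h := hermOf_basis_right_eq horth (u : E) μ
    rw [hη.hermOf_coe_radSpace u (w μ)] at h
    have : w.repr (u : E) μ * c μ = 0 := h.symm
    exact (mul_eq_zero.1 this).resolve_right (by exact_mod_cast hc)
  -- `u = Σ_{μ ∈ Z} a_μ e_μ` inside `radSpace`
  have hu : u = ∑ μ ∈ diagZero c, w.repr (u : E) μ • radFrame hZ μ := by
    apply Subtype.ext
    rw [Submodule.coe_sum]
    conv_lhs => rw [← w.sum_repr (u : E)]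
    rw [← Finset.sum_filter_add_sum_filter_not Finset.univ (fun ν ↦ c ν = 0)]
    have hz : ∑ μ ∈ Finset.univ.filter (fun ν ↦ ¬c ν = 0), w.repr (u : E) μ • w μ = 0 :=
      Finset.sum_eq_zero fun μ hμ ↦ by
        rw [hcoord μ (fun h ↦ (Finset.mem_filter.1 hμ).2 (mem_diagZero.1 h)), zero_smul]
    rw [hz, add_zero]
    refine Finset.sum_congr rfl fun μ hμ ↦ ?_
    rw [Submodule.coe_smul, coe_radFrame_of_mem hZ hμ]
  rw [hu]
  exact Submodule.sum_mem _ fun μ _ ↦ Submodule.smul_mem _ _ (Submodule.subset_span ⟨μ, rfl⟩)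

/-! ### The criterion "`L|_{K(L)⁰}` is trivial" -/

/-- **`χ_0 = 1` iff `χ(λ) = 1` for every lattice vector `λ` in the radical** (Lange: "`L|_{K(L)⁰}` is trivial",
"`χ|_{Λ(L)⁰ ∩ Λ}` is trivial", proof of Lemma 1.5.10). [cite: Lange2023AbelianVarietiesComplex, §1.5.4 Lemma 1.5.10] -/
theorem IsNSForm.radChar_eq_one_iff (hη : IsNSForm Φ η) :
    radChar Φ η χ = 1 ↔ ∀ n : ι → ℤ, (∀ v : E, η ![latticeVec Φ n, v] = 0) → χ n = 1 := by
  constructor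
  · intro h n hn
    -- `n` lies in the radical lattice, hence `n = C n'` for the adapted basis
    have hmem : (fun i ↦ (n i : ℝ)) ∈ nsRadical Φ η := (mem_nsRadical_iff_forall Φ η).2 hn
    have hrange := (range_subtorusMatrix_mulVecLin hη.isLatticeSubspace_nsRadical).symm ▸ hmem
    obtain ⟨y, hy⟩ := hrange
    -- `y` is integral: `y = R n`
    have hy' : y = (retractionMatrix (nsRadical Φ η)).map (Int.cast : ℤ → ℝ) *ᵥ fun i ↦ (n i : ℝ) := by
      have h := congrArg ((retractionMatrix (nsRadical Φ η)).map (Int.cast : ℤ → ℝ)).mulVec hy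
      rw [Matrix.mulVecLin_apply, Matrix.mulVec_mulVec, retractionMatrix_mul_subtorusMatrix_real, Matrix.one_mulVec] at h
      exact h
    set n' : Fin (subRank (nsRadical Φ η)) → ℤ := retractionMatrix (nsRadical Φ η) *ᵥ n with hn'
    have hyn' : y = fun j ↦ (n' j : ℝ) := by
      rw [hy', hn']
      funext j
      simp [Matrix.mulVec, dotProduct, Matrix.map_apply]
    have hnn' : n = subtorusMatrix (nsRadical Φ η) *ᵥ n' := by
      have h2 := hy
      rw [Matrix.mulVecLin_apply, hyn'] at h2
      funext i
      have := congrFun h2 i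
      simp only [Matrix.mulVec, dotProduct, Matrix.map_apply] at this
      exact_mod_cast this.symm
    have h3 := congrFun h n'
    rw [radChar_apply, Pi.one_apply] at h3
    rw [hnn']
    exact h3
  · intro h
    funext n'
    rw [radChar_apply, Pi.one_apply]
    exact h _ (apply_latticeVec_subtorusMatrix_mulVec Φ η n')

/-! ### The headline theorems for an `H`-orthogonal basis -/

variable [FiniteDimensional ℂ E] {k : Fin g → ℝ} (hη : IsNSForm Φ η) (hχ : IsSemicharacter Φ η χ)
  (horth : ∀ μ ν, hermOf η (w μ) (w ν) = if μ = ν then (c μ : ℂ) else 0) (hk : ∀ ν, 0 < k ν)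
  (h1 : radChar Φ η χ ≠ 1)
include hη hχ horth hk h1

/-- **THEOREM (`L|_{K(L)⁰}` non-trivial ⟹ all `∂̄`-closed forms are exact)**: for `L = L(H, χ)` with `χ ≠ 1` on
`Λ ∩ Λ(L)⁰` and any `H`-orthogonal basis `e_ν` of `V` (real diagonal `c_ν`), `Z^{0,q}_∂̄(X, L) = B^{0,q}_∂̄(X, L)` for
`q ≥ 1`. [cite: Lange2023AbelianVarietiesComplex, §1.6.3 Thm. 1.6.8] [cite: HuybrechtsCG2005, §4.1 Thm. 4.1.13] -/
theorem IsNSForm.dbarClosedForms_eq_dbarExactForms_of_radChar_ne_one {q : ℕ} (hq : 1 ≤ q) :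
    dbarClosedForms Φ η χ (⇑w) q = dbarExactForms Φ η χ (⇑w) q :=
  le_antisymm (hη.dbarClosedForms_le_dbarExactForms_of_radChar_ne_one hχ (hη.diagZero_mem_radSpace horth)
    (hη.span_radFrame_diagZero_eq_top horth) hk h1 q) (by
      have := hq; exact dbarExactForms_le_dbarClosedForms (⇑w) q hη hχ)

/-- **THEOREM 1.6.8, "`0` otherwise" (Lange 2023), in the `∂̄`-cohomology: `H^{0,q}_∂̄(X, L(H, χ)) = 0` for every `q`
when `L|_{K(L)⁰}` is non-trivial** — for every `H ∈ NS(X)` and every `H`-orthogonal basis.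
[cite: Lange2023AbelianVarietiesComplex, §1.6.3 Thm. 1.6.8] [cite: Lange2023AbelianVarietiesComplex, §1.6.1 Thm. 1.6.1] -/
theorem IsNSForm.subsingleton_dbarCohomology_basis_of_radChar_ne_one (q : ℕ) :
    Subsingleton (dbarCohomology Φ η χ (⇑w) q) :=
  hη.subsingleton_dbarCohomology_of_radChar_ne_one hχ (hη.diagZero_mem_radSpace horth)
    (hη.span_radFrame_diagZero_eq_top horth) hk h1 q

/-- **`h^q(L) = dim_ℂ H^{0,q}_∂̄(X, L) = 0` for all `q` when `L|_{K(L)⁰}` is non-trivial.**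
[cite: Lange2023AbelianVarietiesComplex, §1.6.3 Thm. 1.6.8] -/
theorem IsNSForm.finrank_dbarCohomology_basis_of_radChar_ne_one (q : ℕ) :
    Module.finrank ℂ (dbarCohomology Φ η χ (⇑w) q) = 0 :=
  hη.finrank_dbarCohomology_of_radChar_ne_one hχ (hη.diagZero_mem_radSpace horth)
    (hη.span_radFrame_diagZero_eq_top horth) hk h1 q

/-- **`ℋ^q(L) = 0` for all `q` when `L|_{K(L)⁰}` is non-trivial** (every `H`-orthogonal basis, all positive weights).
[cite: Lange2023AbelianVarietiesComplex, §1.6.3 Thm. 1.6.8] [cite: Lange2023AbelianVarietiesComplex, §1.6.2 Cor. 1.6.5] -/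
theorem IsNSForm.harmonicForms_basis_eq_bot_of_radChar_ne_one (q : ℕ) :
    hη.harmonicForms (⇑w) k χ q = (⊥ : Submodule ℂ _) :=
  hη.harmonicForms_eq_bot_of_radChar_ne_one hχ (hη.diagZero_mem_radSpace horth)
    (hη.span_radFrame_diagZero_eq_top horth) hk (hermOf_basis_eq_zero_of_ne horth) h1 q

/-- **THEOREM 1.6.1 (Lange 2023) for `L(H, χ)` with `L|_{K(L)⁰}` non-trivial: `ℋ^q(L) → H^{0,q}_∂̄(X, L)` is bijective
in every degree**, for every `H`-orthogonal basis and all positive weights.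
[cite: Lange2023AbelianVarietiesComplex, §1.6.1 Thm. 1.6.1] [cite: HuybrechtsCG2005, §4.1 Cor. 4.1.14] -/
theorem IsNSForm.harmonicToDolbeault_basis_bijective_of_radChar_ne_one (q : ℕ) :
    Function.Bijective (hη.harmonicToDolbeault (b := ⇑w) (q := q) hχ (hermOf_basis_eq_zero_of_ne horth) hk) :=
  hη.harmonicToDolbeault_bijective_of_radChar_ne_one hχ (hη.diagZero_mem_radSpace horth)
    (hη.span_radFrame_diagZero_eq_top horth) hk (hermOf_basis_eq_zero_of_ne horth) h1 q

end DiagZero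

end ComplexTorus

end Literature.Geometry.Kaehler
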